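import Literature.MathematicalPhysics.QuantumFieldTheory.Balaban1983to89.B3Op116MajorantStep
import Literature.MathematicalPhysics.QuantumFieldTheory.Balaban1983to89.B3Op116SliceSums

/-!
# Bałaban, *(Higgs)₂,₃ quantum fields in a finite volume III. Renormalization* [B3] — the kernel of (1.16) p. 414 for a
perturbation supported FAR from the localization points: THE LONG-LEG BOOKKEEPING of the (2.6)/(2.10) majorant currency
(engine file «CollarRows» of the cell's Route δ for the class-(c) sentence of p. 433)

statement-level skeleton of published theorems with citation tags; proofs where landed; nothing here is a claim about the Yang–Mills mass gap

T. Bałaban, Commun. Math. Phys. **88** (1983) 411–445 [cite: Balaban1983Higgs3]; part I, Commun. Math. Phys. **85** (1982) 603–636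
[cite: Balaban1982Higgs1].  PDF held: `paper:balaban1983-higgs-2-3-quantum-fields-finite-volume` (journal page = PDF page + 410;
p. 414 = `p0004.txt`, p. 424 = `p0014.txt`, p. 426 = `p0016.txt`, p. 433 = `p0023.txt`).

CITATION HEADER (lean-in-tree rule).  Cell `lit-balaban` (HOME `run/shared/lean/pub/lit-balaban/`), Phase-2 proof seat **p40** gen 77
(unit `lit-balaban-p40`, literature-prover-lit-balaban-p40-g77-0); free-target protocol G.5-34(d), TAKING line HOME/STATUS.md
2026-08-23T12:41:06Z (cc r15 = fold owner of rows B3.Txt@433 / B3.Prop1 / B3.Eq1.16 / B3.Eq2.5, p35, r14, p33); design note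
`lit-balaban-p40/DESIGN-B3-116-box.md` v3 §5/§5.1 (Route δ), recorded by the owner as the cell's candidate proof-route deviation for
class (c) (HOME/GAPS.md «G-B3-16 ADDENDUM 1», owner note l.2887).  LOCATED ENGINE FILE — no head claim.  USED BY NAME, never restated:
p35's `B3Op116MajorantStep.{maj, top_le_maj, block_avg_maj_le, blkK, maj_shift_right, maj_shift_left, maj_exponent_reduce}` and (v1.1)
`B3Op116SliceSums.face_conv2_scales_le` (p35 g26), p33's
`B3Op116MajorantConvolution.{conv2_scales_le, pair_scale_algebra}`, r14's `B3Op116ScaleChains.{rate_eq, mesh_rpow_add, mesh_succ}`,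
the typer's `HiggsLattice` / `HiggsCovariancePos.sum_site_dir` / `HiggsAveraging.{blockK, blockIter}`.

## What is printed

[B3] p. 414 [PDF 4] (verbatim): *"for n, n′ sufficiently large, a kernel of the operator (1.16) is a sufficiently regular function of
both variables … exponentially decaying with the distance of the arguments and … uniformly bounded by O(1)(e(L^kε)^{1−α})^{n+n′} … This
estimate follows easily from the properties of the propagators G_k(Ω, A) proved in the next paper."*  [B3] p. 426 (2.10) [PDF 16]
(verbatim): *"|G^η_{(j)}(Ω, B̃; x, x′)| ≤ O(1)(L^jη)^{−d+2}e^{−δ₁(L^jη)^{−1}|x−x′|}, (2.10) and if the propagator is differentiated, then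
for each differentiation, there is an additional factor (L^jη)^{−1} on the right side."*  [B3] p. 433 [PDF 23] (verbatim, the class-(c)
sentence this engine serves): *"We have B̃ = B̃₀ + B̃′, and we expand in B̃′ the expressions … using the formulas (I.3.14), (I.3.44), and
(I.3.45) … we include the operators (1.16) … into the external fields"* — with the perturbation supported up to the faces of the cube `□`,
i.e. OUTSIDE the regime of p. 412 («dist(supp Ã, ∂Ω) > 2r(L^kε)») under which the cell's region members of (2.5)/(1.16) are proved
(`B3Ineq25Op116RegularRegion`, p40 g75); the cell's recorded route splits `B̃′ = B̃′χ + B̃′(1 − χ)` by a deep cutoff and treats the collar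
part `P = B̃′(1 − χ)` — supported at distance `≥ R = ρ·L^k` lattice sites from every localization point — by the ONE-`V_k` resolvent
identity (I.3.44); every kernel leg of the resulting rows is then LONG.

## What this file proves, and how (pure real bookkeeping — no field, propagator or region enters)

§1 THE LONG-LEG REDUCTION (`maj_far_le_top`): for `ρ ≥ 1` and a FAR pair `L^kε·ρ ≤ ε|x − y|` (`Far`), p35's range-`k` majorant
`𝔪_k(c,a;δ)(x,y) = Σ_{j<k} c(L^jε)^{a−d}e^{−δ(L^jε)^{−1}ε|x−y|}` (exponent `a ≥ 0`) is a single TOP-SCALE bump with an exponentially small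
constant: `≤ farC(δ)·e^{−δρ/4}·c·(L^kε)^{a−d}·e^{−(δ/2)(L^kε)^{−1}ε|x−y|}` (`top`), UNIFORMLY IN `k`: the scale `j = k − m` pays
`e^{−(δ/2)ρL^m}`, which beats the factor `L^{m(d−a)}` of the finer scale (`(L^m)^d e^{−(δ/4)ρL^m} ≤ (4/δ)^d d!`) and leaves
`e^{−(δ/4)ρ}·e^{−(δ/4)m}`, summable in `m`.  This is what removes, for far arguments, the logarithm `Σ_{j<k} 1 = k` of the `n + n′ = 1`
kernel (G-B3-15) and of the twice-differentiated (mixed) kernel.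
§2 TOP-SCALE TWO-LEG SUMS (`sum_top_mul_top_le`, `sum_bond_top_mul_top_le`): two top bumps of ANY real exponents `a₁, a₂` contracted
over the sites (bonds) of `T_ε` give a top bump of exponent `a₁ + a₂` at half the rate, constant `× N(8d/δ)^d(ε^d)^{−1}` (p33's
`conv2_scales_le` at `j₁ = j₂ = k`) — no sign condition, unlike the range-`k` convolution.
§3 THE FAR PAIRINGS (`sum_far_pair_le`, `sum_bond_far_pair_le`, `sum_far_avg_le`): a kernel majorised from `p` and a state majorised
from `x′`, multiplied and summed over a finite set of FAR sources (both legs far; for the block-averaged states one far leg), are a top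
bump of exponent `a₁ + a₂` from `p` to `x′` with the factor `farF = farC·e^{−δρ/4}`.
§4 **THE COLLAR ROW** (`collar_row_le`): the whole L-form row of `T(V_k(P,Y)w)` — bond terms `κ₁D(b)K(b₊) + (κ₂V(b₋) + κ₁D(b))K(b₋) +
κ₃V(b₊)K(b₊) + κ₅V(b₊)K^D(b)` over far bonds, a site term `κ_FΣV(y)K(y)` over far sites (the face legs of a box), and the averaging term
`κ₄Σ_zK(z)L^{−kd}Σ_{u∈B^k(z̄)}V(u)` over far block sites — is `≤ top(farF·collarC, a_K + a_v − 1; δ/4)(p, x′)`: the input shape of the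
symmetric rows of r14's `B3Op116SourceForm` AND of p35's Leibniz rows, with every source far from `p` and from `x′`; the two-anchor form
`collar_row_two_le` (kernel majorised from `p₁` and `p₂`, as the Hölder-transported differentiated column of (2.11)) by linearity.

§5 (v1.1) THE FACE PAIRINGS (`sum_face_top_mul_top_le`, `sum_face_far_pair_le`): the same over the sites of ONE lattice slice `{s : s_ν = c}`
(a face of a box; p35 g26's `B3Op116SliceSums.face_conv2_scales_le`): the `(d−1)`-dimensional volume lowers the top exponent by one and improves
the normalization by one `ε` — exactly what the face charges `ε^{−1}|e|s‖w(y)‖` of the entering/exiting bonds of `supp P` across `∂□` need (the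
`κ_F` slot of §4, summed over all sites, is NOT adequate for them: it would lose a factor `L^k`).

## Honest scope

Real-number bookkeeping only (abstract nonnegative kernels/states with majorants, finite source sets with the `Far` property); `L ≥ 2`,
`ρ ≥ 1`, `0 < δ ≤ 1`, `k ≤ K` for the block averages; constants explicit (`farC`, `pairC`, `collarC`), uniform in `k` and in the volume,
not optimized.  Nothing of (1.16)/(2.5) itself is asserted here; the class-(c) use on the cube `□` is a RECORDED ROUTE DEVIATION from
p. 433 l.12–15 (print's one-piece expansion on `□` is the cell's located open gap G-B3-16.A1), and this file is only its lattice-sum engine.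
Concrete `def`s (`Far`, `top`, `farC`, `farF`, `pairC`, `collarC`, `faceC`); no `def … : Prop` fact, no new named fact, no `sorry`; axioms standard.
-/

noncomputable section

open scoped BigOperators

namespace Literature.MathematicalPhysics.QuantumFieldTheory.Balaban1983to89.B3Op116CollarRows

open B1Eq230FluctCov (Ix)
open B1Ineq234Concrete (nCol)
open B1Ineq234LevelZero (tdist_comm)
open HiggsAveraging (blockK blockIter)
open HiggsCovariancePos (sum_site_dir)
open B3Op116MajorantStep (maj maj_nonneg maj_shift_right maj_shift_left block_avg_maj_le blkK blkK_nonneg)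
open B3Op116MajorantConvolution (conv2_scales_le pair_scale_algebra)
open B3Op116ScaleChains (rate_eq mesh_rpow_add)

variable {P : HiggsLattice.Params} {N : ℕ}

/-! ## §1 Far pairs, top-scale bumps, and the long-leg reduction of a majorant -/

section Far

/-- **Far pairs at scale `k` with margin `ρ`**: `ρ·L^kε ≤ ε|x − y|` — the source `y` lies at least `ρ` `k`-blocks (in lattice distance
`R = ρL^k` fine sites) from `x`; the geometry of the collar of the cell's Route δ for p. 433. [cite: Balaban1983Higgs3, p.433, (2.10) p.426] -/
def Far (P : HiggsLattice.Params) (k : ℕ) (ρ : ℝ) (x y : HiggsLattice.Site P 0) : Prop :=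
  P.mesh k * ρ ≤ P.mesh 0 * (HiggsLattice.Site.tdist x y : ℝ)

/-- `Far` is symmetric. [cite: Balaban1983Higgs3, (2.10) p.426] -/
theorem Far.symm {k : ℕ} {ρ : ℝ} {x y : HiggsLattice.Site P 0} (h : Far P k ρ x y) : Far P k ρ y x := by
  unfold Far at h ⊢; rwa [tdist_comm y x]

/-- **The top-scale bump** `top_k(c,a;δ)(x,y) = c·(L^kε)^{a−d}·e^{−δ(L^kε)^{−1}ε|x−y|}` — the shape of the `j = k` term of (2.6)/(2.10),
which dominates every far leg. [cite: Balaban1983Higgs3, (2.6) p.424, (2.10) p.426] -/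
def top (P : HiggsLattice.Params) (k : ℕ) (c a δ : ℝ) (x y : HiggsLattice.Site P 0) : ℝ :=
  c * P.mesh k ^ (a - (P.d : ℝ)) * Real.exp (-(δ * (P.mesh k)⁻¹ * (P.mesh 0 * (HiggsLattice.Site.tdist x y : ℝ))))

/-- `top ≥ 0` for `c ≥ 0`. [cite: Balaban1983Higgs3, (2.10) p.426] -/
theorem top_nonneg {k : ℕ} {c a δ : ℝ} (hc : 0 ≤ c) (x y : HiggsLattice.Site P 0) : 0 ≤ top P k c a δ x y :=
  mul_nonneg (mul_nonneg hc (Real.rpow_nonneg (P.mesh_pos k).le _)) (Real.exp_nonneg _)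

/-- `top` is symmetric in its sites. [cite: Balaban1983Higgs3, (2.10) p.426] -/
theorem top_comm (k : ℕ) (c a δ : ℝ) (x y : HiggsLattice.Site P 0) : top P k c a δ x y = top P k c a δ y x := by
  simp only [top, tdist_comm x y]

/-- `top` is homogeneous in the constant. [cite: Balaban1983Higgs3, (2.10) p.426] -/
theorem mul_top (k : ℕ) (r c a δ : ℝ) (x y : HiggsLattice.Site P 0) : r * top P k c a δ x y = top P k (r * c) a δ x y := by
  simp only [top]; ring

/-- `top` is additive in the constant. [cite: Balaban1983Higgs3, (2.10) p.426] -/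
theorem top_add (k : ℕ) (c c' a δ : ℝ) (x y : HiggsLattice.Site P 0) :
    top P k c a δ x y + top P k c' a δ x y = top P k (c + c') a δ x y := by
  simp only [top]; ring

/-- A larger constant gives a larger top bump. [cite: Balaban1983Higgs3, (2.10) p.426] -/
theorem top_const_mono {k : ℕ} {c c' a δ : ℝ} (h : c ≤ c') (x y : HiggsLattice.Site P 0) : top P k c a δ x y ≤ top P k c' a δ x y :=
  mul_le_mul_of_nonneg_right (mul_le_mul_of_nonneg_right h (Real.rpow_nonneg (P.mesh_pos k).le _)) (Real.exp_nonneg _)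

/-- A smaller rate gives a larger top bump (`c ≥ 0`). [cite: Balaban1983Higgs3, (2.10) p.426] -/
theorem top_rate_mono {k : ℕ} {c a δ δ' : ℝ} (hc : 0 ≤ c) (h : δ' ≤ δ) (x y : HiggsLattice.Site P 0) :
    top P k c a δ x y ≤ top P k c a δ' x y := by
  refine mul_le_mul_of_nonneg_left (Real.exp_le_exp.mpr ?_) (mul_nonneg hc (Real.rpow_nonneg (P.mesh_pos k).le _))
  have ht : 0 ≤ (P.mesh k)⁻¹ * (P.mesh 0 * (HiggsLattice.Site.tdist x y : ℝ)) :=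
    mul_nonneg (inv_nonneg.mpr (P.mesh_pos k).le) (mul_nonneg (P.mesh_pos 0).le (Nat.cast_nonneg _))
  have := mul_le_mul_of_nonneg_right h ht
  rw [mul_assoc, mul_assoc]; linarith

/-- **Exponents are interchangeable at the top scale**: `top_k(c, a) = top_k(c·(L^kε)^{a−a′}, a′)` (exactly, no loss).
[cite: Balaban1983Higgs3, (2.6) p.424, (2.10) p.426] -/
theorem top_exponent (k : ℕ) (c a a' δ : ℝ) (x y : HiggsLattice.Site P 0) :
    top P k c a δ x y = top P k (c * P.mesh k ^ (a - a')) a' δ x y := by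
  simp only [top]
  rw [show a - (P.d : ℝ) = (a - a') + (a' - (P.d : ℝ)) by ring, ← mesh_rpow_add]
  ring

/-- One power of the top scale: `top_k(c, a + 1) = top_k(c·L^kε, a)`. [cite: Balaban1983Higgs3, (2.6) p.424, (2.10) p.426] -/
theorem top_exponent_succ (k : ℕ) (c a δ : ℝ) (x y : HiggsLattice.Site P 0) :
    top P k c (a + 1) δ x y = top P k (c * P.mesh k) a δ x y := by
  rw [top_exponent k c (a + 1) a δ x y, show a + 1 - a = (1 : ℝ) by ring, Real.rpow_one]

/-- `L^kε = L^{k−j}·L^jε` for `j ≤ k`. [cite: Balaban1982Higgs1, (1.19) p.607] -/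
theorem mesh_eq_pow_mul_mesh {j k : ℕ} (hjk : j ≤ k) : P.mesh k = (P.L : ℝ) ^ (k - j) * P.mesh j := by
  unfold HiggsLattice.Params.mesh
  rw [← mul_assoc, ← pow_add, Nat.sub_add_cancel hjk]

/-- A one-bond shift of the second site of a top bump costs `e` (`0 ≤ δ ≤ 1`; `ε ≤ L^kε`). [cite: Balaban1983Higgs3, (2.10) p.426] [cite: Balaban1982Higgs1, (1.3) p.604] -/
theorem top_shift_right {k : ℕ} {c a δ : ℝ} (hδ : 0 ≤ δ) (hδ1 : δ ≤ 1) (hc : 0 ≤ c) (x y : HiggsLattice.Site P 0) (μ : Fin P.d) :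
    top P k c a δ x (y.shift μ) ≤ top P k (Real.exp 1 * c) a δ x y := by
  simp only [top, rate_eq]
  have hL1 : (1 : ℝ) ≤ (P.L : ℝ) ^ k := one_le_pow₀ (by exact_mod_cast P.hL)
  have hr0 : 0 ≤ δ / (P.L : ℝ) ^ k := by positivity
  have hr1 : δ / (P.L : ℝ) ^ k ≤ 1 := (div_le_self hδ hL1).trans hδ1
  have h := B3Op116ScaleChains.exp_tdist_shift_le' hr0 x y μ
  have hcm : 0 ≤ c * P.mesh k ^ (a - (P.d : ℝ)) := mul_nonneg hc (Real.rpow_nonneg (P.mesh_pos k).le _)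
  calc c * P.mesh k ^ (a - (P.d : ℝ)) * Real.exp (-(δ / (P.L : ℝ) ^ k * (HiggsLattice.Site.tdist x (y.shift μ) : ℝ)))
      ≤ c * P.mesh k ^ (a - (P.d : ℝ)) * (Real.exp (δ / (P.L : ℝ) ^ k) *
          Real.exp (-(δ / (P.L : ℝ) ^ k * (HiggsLattice.Site.tdist x y : ℝ)))) := mul_le_mul_of_nonneg_left h hcm
    _ ≤ c * P.mesh k ^ (a - (P.d : ℝ)) * (Real.exp 1 * Real.exp (-(δ / (P.L : ℝ) ^ k * (HiggsLattice.Site.tdist x y : ℝ)))) :=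
        mul_le_mul_of_nonneg_left (mul_le_mul_of_nonneg_right (Real.exp_le_exp.mpr hr1) (Real.exp_nonneg _)) hcm
    _ = _ := by ring

/-- The same in the first site. [cite: Balaban1983Higgs3, (2.10) p.426] [cite: Balaban1982Higgs1, (1.3) p.604] -/
theorem top_shift_left {k : ℕ} {c a δ : ℝ} (hδ : 0 ≤ δ) (hδ1 : δ ≤ 1) (hc : 0 ≤ c) (x y : HiggsLattice.Site P 0) (μ : Fin P.d) :
    top P k c a δ (x.shift μ) y ≤ top P k (Real.exp 1 * c) a δ x y := by
  rw [top_comm, top_comm k (Real.exp 1 * c)]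
  exact top_shift_right hδ hδ1 hc y x μ

/-- **One far leg at one scale**: for `j ≤ k`, `δ, ρ ≥ 0` and a far pair, the scale-`j` bump splits off the double-exponential factor
`e^{−(δ/2)ρ·L^kε/L^jε}` and keeps half its decay AT THE TOP SCALE:
`e^{−δ(L^jε)^{−1}ε|x−y|} ≤ e^{−(δ/2)ρL^kε(L^jε)^{−1}}·e^{−(δ/2)(L^kε)^{−1}ε|x−y|}`. [cite: Balaban1983Higgs3, (2.10) p.426, p.433] -/
theorem bump_far_le {j k : ℕ} (hjk : j ≤ k) {δ ρ : ℝ} (hδ : 0 ≤ δ) {x y : HiggsLattice.Site P 0} (hfar : Far P k ρ x y) :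
    Real.exp (-(δ * (P.mesh j)⁻¹ * (P.mesh 0 * (HiggsLattice.Site.tdist x y : ℝ))))
      ≤ Real.exp (-(δ / 2 * ρ * (P.mesh k * (P.mesh j)⁻¹))) *
          Real.exp (-(δ / 2 * (P.mesh k)⁻¹ * (P.mesh 0 * (HiggsLattice.Site.tdist x y : ℝ)))) := by
  set T : ℝ := P.mesh 0 * (HiggsLattice.Site.tdist x y : ℝ) with hT
  have hT0 : 0 ≤ T := mul_nonneg (P.mesh_pos 0).le (Nat.cast_nonneg _)
  have hmj : 0 < P.mesh j := P.mesh_pos j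
  have hmk : 0 < P.mesh k := P.mesh_pos k
  -- `L^jε ≤ L^kε` (the tree's `B2Prop31ZeroFieldConcrete.mesh_le_mesh`, inlined to keep the imports light)
  have hjk' : P.mesh j ≤ P.mesh k := by
    unfold HiggsLattice.Params.mesh
    have hL1 : (1 : ℝ) ≤ (P.L : ℝ) := by exact_mod_cast P.hL
    exact mul_le_mul_of_nonneg_right (pow_le_pow_right₀ hL1 hjk) P.hε.le
  rw [← Real.exp_add, Real.exp_le_exp]
  have h1 : δ / 2 * ρ * (P.mesh k * (P.mesh j)⁻¹) ≤ δ / 2 * ((P.mesh j)⁻¹ * T) := by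
    have hf : P.mesh k * ρ ≤ T := hfar
    calc δ / 2 * ρ * (P.mesh k * (P.mesh j)⁻¹) = δ / 2 * (P.mesh j)⁻¹ * (P.mesh k * ρ) := by ring
      _ ≤ δ / 2 * (P.mesh j)⁻¹ * T := mul_le_mul_of_nonneg_left hf (by positivity)
      _ = δ / 2 * ((P.mesh j)⁻¹ * T) := by ring
  have h2 : δ / 2 * ((P.mesh k)⁻¹ * T) ≤ δ / 2 * ((P.mesh j)⁻¹ * T) :=
    mul_le_mul_of_nonneg_left (mul_le_mul_of_nonneg_right (inv_anti₀ hmj hjk') hT0) (by positivity)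
  have h3 : δ * (P.mesh j)⁻¹ * T = δ / 2 * ((P.mesh j)⁻¹ * T) + δ / 2 * ((P.mesh j)⁻¹ * T) := by ring
  rw [h3]
  have h4 : δ / 2 * (P.mesh k)⁻¹ * T = δ / 2 * ((P.mesh k)⁻¹ * T) := by ring
  rw [h4]
  linarith

/-- **The finer scale's power is beaten by the double exponential**: for `m ≥ 0`, `a ≥ 0`, `L ≥ 2`, `δ > 0`, `ρ ≥ 1`,
`(L^m)^{d−a}·e^{−(δ/2)ρL^m} ≤ (4/δ)^d·d!·e^{−(δ/4)ρ}·e^{−(δ/4)m}` (`x^d ≤ d!e^x` at `x = (δ/4)ρL^m`, then `ρL^m ≥ ρ + m`).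
[cite: Balaban1983Higgs3, (2.6) p.424, (2.10) p.426] -/
theorem pow_mul_exp_neg_le (hL2 : 2 ≤ P.L) (m : ℕ) {a δ ρ : ℝ} (ha : 0 ≤ a) (hδ : 0 < δ) (hρ : 1 ≤ ρ) :
    ((P.L : ℝ) ^ m) ^ ((P.d : ℝ) - a) * Real.exp (-(δ / 2 * ρ * (P.L : ℝ) ^ m))
      ≤ (4 / δ) ^ P.d * (P.d.factorial : ℝ) * Real.exp (-(δ / 4 * ρ)) * Real.exp (-(δ / 4 * (m : ℝ))) := by
  set Lm : ℝ := (P.L : ℝ) ^ m with hLm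
  have hL1 : (1 : ℝ) ≤ (P.L : ℝ) := by exact_mod_cast P.hL
  have hLm1 : 1 ≤ Lm := one_le_pow₀ hL1
  have hLm0 : 0 ≤ Lm := zero_le_one.trans hLm1
  -- `L^m ≥ m + 1` for `L ≥ 2`
  have hLm_ge : (m : ℝ) + 1 ≤ Lm := by
    have h2 : m < 2 ^ m := Nat.lt_pow_self (by norm_num)
    have h3 : (2 : ℝ) ^ m ≤ Lm := by
      rw [hLm]; exact pow_le_pow_left₀ (by norm_num) (by exact_mod_cast hL2) m
    have h4 : ((m : ℕ) : ℝ) + 1 ≤ (2 : ℝ) ^ m := by exact_mod_cast h2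
    linarith
  -- (iii) drop `a` from the exponent
  have step1 : Lm ^ ((P.d : ℝ) - a) ≤ Lm ^ P.d := by
    rw [← Real.rpow_natCast]
    exact Real.rpow_le_rpow_of_exponent_le hLm1 (by linarith)
  -- (iv) `Lm^d ≤ (4/(δρ))^d d! e^{x}`, `x = (δ/4)ρLm`
  set x : ℝ := δ / 4 * ρ * Lm with hx
  have hρ0 : 0 < ρ := lt_of_lt_of_le zero_lt_one hρ
  have hx0 : 0 ≤ x := by positivity
  have hLm_eq : Lm = 4 / (δ * ρ) * x := by
    rw [hx]; field_simp
  have hfact : 0 < (P.d.factorial : ℝ) := by exact_mod_cast P.d.factorial_pos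
  have step2 : Lm ^ P.d ≤ (4 / (δ * ρ)) ^ P.d * (P.d.factorial : ℝ) * Real.exp x := by
    have h := Real.pow_div_factorial_le_exp x hx0 P.d
    rw [div_le_iff₀ hfact] at h
    rw [hLm_eq, mul_pow]
    calc (4 / (δ * ρ)) ^ P.d * x ^ P.d ≤ (4 / (δ * ρ)) ^ P.d * (Real.exp x * (P.d.factorial : ℝ)) :=
          mul_le_mul_of_nonneg_left h (pow_nonneg (by positivity) _)
      _ = _ := by ring
  have step3 : (4 / (δ * ρ)) ^ P.d ≤ (4 / δ) ^ P.d := by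
    refine pow_le_pow_left₀ (by positivity) ?_ _
    exact div_le_div_of_nonneg_left (by norm_num) hδ (le_mul_of_one_le_right hδ.le hρ)
  -- (v) `e^{x}·e^{−2x} = e^{−x} ≤ e^{−(δ/4)ρ}e^{−(δ/4)m}`
  have hexp2 : Real.exp (-(δ / 2 * ρ * Lm)) = Real.exp (-x) * Real.exp (-x) := by
    rw [← Real.exp_add, hx]; ring_nf
  have step4 : Real.exp (-x) ≤ Real.exp (-(δ / 4 * ρ)) * Real.exp (-(δ / 4 * (m : ℝ))) := by
    rw [← Real.exp_add, Real.exp_le_exp, hx]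
    have : ρ + (m : ℝ) ≤ ρ * Lm := by nlinarith
    nlinarith
  calc Lm ^ ((P.d : ℝ) - a) * Real.exp (-(δ / 2 * ρ * Lm))
      ≤ Lm ^ P.d * Real.exp (-(δ / 2 * ρ * Lm)) := mul_le_mul_of_nonneg_right step1 (Real.exp_nonneg _)
    _ = Lm ^ P.d * Real.exp (-x) * Real.exp (-x) := by rw [hexp2]; ring
    _ ≤ (4 / (δ * ρ)) ^ P.d * (P.d.factorial : ℝ) * Real.exp x * Real.exp (-x) * Real.exp (-x) :=
        mul_le_mul_of_nonneg_right (mul_le_mul_of_nonneg_right step2 (Real.exp_nonneg _)) (Real.exp_nonneg _)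
    _ = (4 / (δ * ρ)) ^ P.d * (P.d.factorial : ℝ) * Real.exp (-x) := by
        have : Real.exp x * Real.exp (-x) = 1 := by rw [← Real.exp_add, add_neg_cancel, Real.exp_zero]
        calc (4 / (δ * ρ)) ^ P.d * (P.d.factorial : ℝ) * Real.exp x * Real.exp (-x) * Real.exp (-x)
            = (4 / (δ * ρ)) ^ P.d * (P.d.factorial : ℝ) * (Real.exp x * Real.exp (-x)) * Real.exp (-x) := by ring
          _ = _ := by rw [this, mul_one]
    _ ≤ (4 / δ) ^ P.d * (P.d.factorial : ℝ) * (Real.exp (-(δ / 4 * ρ)) * Real.exp (-(δ / 4 * (m : ℝ)))) :=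
        mul_le_mul (mul_le_mul_of_nonneg_right step3 hfact.le) step4 (Real.exp_nonneg _) (by positivity)
    _ = _ := by ring

/-- **The geometric tail `Σ_{j<k} e^{−(δ/4)(k−j)} ≤ 4/δ`** (`δ > 0`), uniformly in `k`. [cite: Balaban1983Higgs3, (2.6) p.424] -/
theorem sum_exp_neg_sub_le (k : ℕ) {δ : ℝ} (hδ : 0 < δ) :
    ∑ j ∈ Finset.range k, Real.exp (-(δ / 4 * ((k - j : ℕ) : ℝ))) ≤ 4 / δ := by
  set r : ℝ := Real.exp (-(δ / 4)) with hr
  have hr0 : 0 < r := Real.exp_pos _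
  have hr1 : r < 1 := Real.exp_lt_one_iff.mpr (by linarith)
  -- reflect: `k − j = (k − 1 − j) + 1` on `range k`
  have hrefl : ∑ j ∈ Finset.range k, Real.exp (-(δ / 4 * ((k - j : ℕ) : ℝ)))
      = ∑ i ∈ Finset.range k, r ^ (i + 1) := by
    rw [← Finset.sum_range_reflect (fun i => r ^ (i + 1)) k]
    refine Finset.sum_congr rfl fun j hj => ?_
    have hjk : j < k := Finset.mem_range.1 hj
    have : k - 1 - j + 1 = k - j := by omega
    rw [this, hr, ← Real.exp_nat_mul]
    congr 1; ring
  rw [hrefl]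
  have hgeom : ∑ i ∈ Finset.range k, r ^ (i + 1) = r * ((r ^ k - 1) / (r - 1)) := by
    rw [← geom_sum_eq hr1.ne k, Finset.mul_sum]
    exact Finset.sum_congr rfl fun i _ => by ring
  rw [hgeom]
  have h1 : (r ^ k - 1) / (r - 1) ≤ 1 / (1 - r) := by
    rw [show (r ^ k - 1) / (r - 1) = (1 - r ^ k) / (1 - r) by
      rw [div_eq_div_iff (by linarith : r - 1 ≠ 0) (by linarith : (1 : ℝ) - r ≠ 0)]; ring]
    exact div_le_div_of_nonneg_right (by linarith [pow_pos hr0 k]) (by linarith)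
  -- `r/(1−r) = 1/(e^{δ/4} − 1) ≤ 4/δ`
  have h2 : r * (1 / (1 - r)) ≤ 4 / δ := by
    have he : δ / 4 + 1 ≤ Real.exp (δ / 4) := Real.add_one_le_exp _
    have hre : r * Real.exp (δ / 4) = 1 := by rw [hr, ← Real.exp_add, neg_add_cancel, Real.exp_zero]
    rw [mul_one_div, div_le_div_iff₀ (by linarith) hδ]
    -- `r δ ≤ 4(1 − r)` ⟸ `r(δ/4 + 1) ≤ 1 = r e^{δ/4}`
    nlinarith [mul_le_mul_of_nonneg_left he hr0.le]
  exact (mul_le_mul_of_nonneg_left h1 hr0.le).trans h2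

/-- the constant of the long-leg reduction, `farC(δ) = (4/δ)^d·d!·(4/δ)`. [cite: Balaban1983Higgs3, (2.10) p.426] -/
def farC (P : HiggsLattice.Params) (δ : ℝ) : ℝ := (4 / δ) ^ P.d * (P.d.factorial : ℝ) * (4 / δ)

/-- `farC > 0` for `δ > 0`. [cite: Balaban1983Higgs3, (2.10) p.426] -/
theorem farC_pos {δ : ℝ} (hδ : 0 < δ) : 0 < farC P δ := by
  have : 0 < (P.d.factorial : ℝ) := by exact_mod_cast P.d.factorial_pos
  unfold farC; positivity

/-- the far factor `farF(δ,ρ) = farC(δ)·e^{−(δ/4)ρ}` — exponentially small in the margin `ρ`. [cite: Balaban1983Higgs3, (2.10) p.426, p.433] -/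
def farF (P : HiggsLattice.Params) (δ ρ : ℝ) : ℝ := farC P δ * Real.exp (-(δ / 4 * ρ))

/-- `farF > 0`. [cite: Balaban1983Higgs3, (2.10) p.426] -/
theorem farF_pos {δ : ℝ} (hδ : 0 < δ) (ρ : ℝ) : 0 < farF P δ ρ := mul_pos (farC_pos hδ) (Real.exp_pos _)

/-- `farF ≤ farC` (the exponential factor is `≤ 1` for `δ, ρ ≥ 0`). [cite: Balaban1983Higgs3, (2.10) p.426] -/
theorem farF_le_farC {δ ρ : ℝ} (hδ : 0 < δ) (hρ : 0 ≤ ρ) : farF P δ ρ ≤ farC P δ := by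
  unfold farF
  have : Real.exp (-(δ / 4 * ρ)) ≤ 1 := Real.exp_le_one_iff.mpr (by nlinarith)
  exact (mul_le_mul_of_nonneg_left this (farC_pos hδ).le).trans (le_of_eq (mul_one _))

/-- **THE LONG-LEG REDUCTION.**  For `L ≥ 2`, `δ > 0`, `ρ ≥ 1`, `c ≥ 0`, exponent `a ≥ 0` and a FAR pair `ρL^kε ≤ ε|x−y|`:
`𝔪_k(c,a;δ)(x,y) ≤ top_k(farC(δ)e^{−δρ/4}·c, a; δ/2)(x,y)` — p35's range-`k` majorant of a far pair is ONE top-scale bump with an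
exponentially small constant, UNIFORMLY IN `k` (scale `j = k − m` pays `e^{−(δ/2)ρL^m}` against `L^{m(d−a)}`).
[cite: Balaban1983Higgs3, (2.6) p.424, (2.10) p.426, p.433] -/
theorem maj_far_le_top (hL2 : 2 ≤ P.L) {k : ℕ} {c a δ ρ : ℝ} (hc : 0 ≤ c) (ha : 0 ≤ a) (hδ : 0 < δ) (hρ : 1 ≤ ρ)
    {x y : HiggsLattice.Site P 0} (hfar : Far P k ρ x y) :
    maj P k c a δ x y ≤ top P k (farF P δ ρ * c) a (δ / 2) x y := by
  set E : ℝ := Real.exp (-(δ / 2 * (P.mesh k)⁻¹ * (P.mesh 0 * (HiggsLattice.Site.tdist x y : ℝ)))) with hE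
  have hE0 : 0 ≤ E := Real.exp_nonneg _
  have hmk : 0 < P.mesh k := P.mesh_pos k
  have hL0 : (0 : ℝ) < (P.L : ℝ) := by exact_mod_cast P.hL
  set A : ℝ := (4 / δ) ^ P.d * (P.d.factorial : ℝ) * Real.exp (-(δ / 4 * ρ)) with hA
  have hA0 : 0 ≤ A := by
    have : 0 < (P.d.factorial : ℝ) := by exact_mod_cast P.d.factorial_pos
    rw [hA]; positivity
  -- each scale
  have hterm : ∀ j ∈ Finset.range k,
      c * P.mesh j ^ (a - (P.d : ℝ)) * Real.exp (-(δ * (P.mesh j)⁻¹ * (P.mesh 0 * (HiggsLattice.Site.tdist x y : ℝ))))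
        ≤ c * P.mesh k ^ (a - (P.d : ℝ)) * E * A * Real.exp (-(δ / 4 * ((k - j : ℕ) : ℝ))) := by
    intro j hj
    have hjk : j ≤ k := (Finset.mem_range.1 hj).le
    have hmj : 0 < P.mesh j := P.mesh_pos j
    set Lm : ℝ := (P.L : ℝ) ^ (k - j) with hLm
    have hLm0 : 0 < Lm := pow_pos hL0 _
    have hmesh : P.mesh k = Lm * P.mesh j := mesh_eq_pow_mul_mesh hjk
    -- the far split
    have hb := bump_far_le hjk hδ.le hfar
    have hratio : P.mesh k * (P.mesh j)⁻¹ = Lm := by rw [hmesh, mul_assoc, mul_inv_cancel₀ hmj.ne', mul_one]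
    rw [hratio] at hb
    -- the scale power
    have hpow : P.mesh j ^ (a - (P.d : ℝ)) = P.mesh k ^ (a - (P.d : ℝ)) * Lm ^ ((P.d : ℝ) - a) := by
      rw [hmesh, Real.mul_rpow hLm0.le hmj.le]
      have : Lm ^ (a - (P.d : ℝ)) * Lm ^ ((P.d : ℝ) - a) = 1 := by
        rw [← Real.rpow_add hLm0, show a - (P.d : ℝ) + ((P.d : ℝ) - a) = 0 by ring, Real.rpow_zero]
      calc P.mesh j ^ (a - (P.d : ℝ)) = P.mesh j ^ (a - (P.d : ℝ)) * (Lm ^ (a - (P.d : ℝ)) * Lm ^ ((P.d : ℝ) - a)) := by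
            rw [this, mul_one]
        _ = _ := by ring
    have hq := pow_mul_exp_neg_le hL2 (k - j) ha hδ hρ
    rw [← hLm] at hq
    have hcm : 0 ≤ c * P.mesh k ^ (a - (P.d : ℝ)) := mul_nonneg hc (Real.rpow_nonneg hmk.le _)
    calc c * P.mesh j ^ (a - (P.d : ℝ)) * Real.exp (-(δ * (P.mesh j)⁻¹ * (P.mesh 0 * (HiggsLattice.Site.tdist x y : ℝ))))
        ≤ c * P.mesh j ^ (a - (P.d : ℝ)) * (Real.exp (-(δ / 2 * ρ * Lm)) * E) :=
          mul_le_mul_of_nonneg_left hb (mul_nonneg hc (Real.rpow_nonneg hmj.le _))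
      _ = c * P.mesh k ^ (a - (P.d : ℝ)) * E * (Lm ^ ((P.d : ℝ) - a) * Real.exp (-(δ / 2 * ρ * Lm))) := by rw [hpow]; ring
      _ ≤ c * P.mesh k ^ (a - (P.d : ℝ)) * E * ((4 / δ) ^ P.d * (P.d.factorial : ℝ) * Real.exp (-(δ / 4 * ρ)) *
            Real.exp (-(δ / 4 * ((k - j : ℕ) : ℝ)))) := mul_le_mul_of_nonneg_left hq (mul_nonneg hcm hE0)
      _ = _ := by rw [hA]; ring
  calc maj P k c a δ x y
      ≤ ∑ j ∈ Finset.range k, c * P.mesh k ^ (a - (P.d : ℝ)) * E * A * Real.exp (-(δ / 4 * ((k - j : ℕ) : ℝ))) :=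
        Finset.sum_le_sum hterm
    _ = c * P.mesh k ^ (a - (P.d : ℝ)) * E * A * ∑ j ∈ Finset.range k, Real.exp (-(δ / 4 * ((k - j : ℕ) : ℝ))) := by
        rw [Finset.mul_sum]
    _ ≤ c * P.mesh k ^ (a - (P.d : ℝ)) * E * A * (4 / δ) :=
        mul_le_mul_of_nonneg_left (sum_exp_neg_sub_le k hδ) (by positivity)
    _ = top P k (farF P δ ρ * c) a (δ / 2) x y := by
        rw [top, farF, farC, hA, hE]; ring

end Far

/-! ## §2 Top-scale two-leg sums: any exponents, half the rate -/

section TopSums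

/-- p33's pair constant at one scale, `pairC(δ) = N(8d/δ)^d(ε^d)^{−1}` (`conv2_scales_le`): the volume of a `k`-block against one
`(L^kε)^{−d}` leaves the matrix-entry normalization `ε^{−d}`. [cite: Balaban1983Higgs3, (2.6) p.424, (2.10) p.426] -/
def pairC (P : HiggsLattice.Params) (N : ℕ) (δ : ℝ) : ℝ := (nCol N : ℝ) * (8 * P.d / δ) ^ P.d * (P.mesh 0 ^ P.d)⁻¹

/-- `pairC ≥ 0` for `δ > 0`. [cite: Balaban1983Higgs3, (2.10) p.426] -/
theorem pairC_nonneg {δ : ℝ} (hδ : 0 < δ) : 0 ≤ pairC P N δ := by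
  have := P.mesh_pos 0
  unfold pairC; positivity

/-- the scale algebra of two top bumps: `(L^kε)^{a₁−d}(L^kε)^{a₂−d}(L^k)^d = (L^kε)^{a₁+a₂−d}(ε^d)^{−1}` (p33's `pair_scale_algebra` at
`j₁ = j₂ = k`). [cite: Balaban1983Higgs3, (2.6) p.424, (2.10) p.426] -/
theorem top_scale_algebra (k : ℕ) (a₁ a₂ : ℝ) :
    P.mesh k ^ (a₁ - (P.d : ℝ)) * P.mesh k ^ (a₂ - (P.d : ℝ)) * ((P.L : ℝ) ^ k) ^ P.d
      = P.mesh k ^ (a₁ + a₂ - (P.d : ℝ)) * (P.mesh 0 ^ P.d)⁻¹ := by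
  have h := pair_scale_algebra (P := P) k k a₁ a₂
  rw [min_self, max_self] at h
  rw [h, mesh_rpow_add, Real.rpow_sub (P.mesh_pos k), Real.rpow_natCast, div_eq_mul_inv]

/-- **Two top bumps contracted over the sites of `T_ε`** (ANY real exponents `a₁, a₂`; `0 < δ ≤ 1`): if `0 ≤ F(u) ≤ top_k(c₁,a₁;δ)(x,u)`
and `0 ≤ G(u) ≤ top_k(c₂,a₂;δ)(u,y)`, then `Σ_u F(u)G(u) ≤ top_k(c₁c₂·pairC(δ), a₁+a₂; δ/2)(x,y)` — p33's `conv2_scales_le` at `j₁ = j₂ = k`.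
[cite: Balaban1983Higgs3, (2.6) p.424, (2.10) p.426] [cite: Balaban1983RegularityDecay, Sect. 5 Theorem p.594] -/
theorem sum_top_mul_top_le {k : ℕ} {δ : ℝ} (hδ : 0 < δ) (hδ1 : δ ≤ 1) {a₁ a₂ c₁ c₂ : ℝ} (hc₁ : 0 ≤ c₁) (hc₂ : 0 ≤ c₂) (i₀ : Ix N)
    (x y : HiggsLattice.Site P 0) (F G : HiggsLattice.Site P 0 → ℝ) (hF0 : ∀ u, 0 ≤ F u) (hG0 : ∀ u, 0 ≤ G u)
    (hF : ∀ u, F u ≤ top P k c₁ a₁ δ x u) (hG : ∀ u, G u ≤ top P k c₂ a₂ δ u y) :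
    ∑ u : HiggsLattice.Site P 0, F u * G u ≤ top P k (c₁ * c₂ * pairC P N δ) (a₁ + a₂) (δ / 2) x y := by
  have hconv := conv2_scales_le (P := P) (N := N) hδ hδ1 k k x y i₀
  rw [min_self, max_self] at hconv
  set E : HiggsLattice.Site P 0 → ℝ := fun u =>
    Real.exp (-(δ * (P.mesh k)⁻¹ * (P.mesh 0 * (HiggsLattice.Site.tdist x u : ℝ)))) *
      Real.exp (-(δ * (P.mesh k)⁻¹ * (P.mesh 0 * (HiggsLattice.Site.tdist u y : ℝ)))) with hE
  have hm : 0 ≤ c₁ * c₂ * (P.mesh k ^ (a₁ - (P.d : ℝ)) * P.mesh k ^ (a₂ - (P.d : ℝ))) :=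
    mul_nonneg (mul_nonneg hc₁ hc₂) (mul_nonneg (Real.rpow_nonneg (P.mesh_pos k).le _) (Real.rpow_nonneg (P.mesh_pos k).le _))
  calc ∑ u : HiggsLattice.Site P 0, F u * G u
      ≤ ∑ u : HiggsLattice.Site P 0, top P k c₁ a₁ δ x u * top P k c₂ a₂ δ u y :=
        Finset.sum_le_sum fun u _ => mul_le_mul (hF u) (hG u) (hG0 u) ((hF0 u).trans (hF u))
    _ = c₁ * c₂ * (P.mesh k ^ (a₁ - (P.d : ℝ)) * P.mesh k ^ (a₂ - (P.d : ℝ))) * ∑ u : HiggsLattice.Site P 0, E u := by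
        rw [Finset.mul_sum]
        exact Finset.sum_congr rfl fun u _ => by simp only [top, hE]; ring
    _ ≤ c₁ * c₂ * (P.mesh k ^ (a₁ - (P.d : ℝ)) * P.mesh k ^ (a₂ - (P.d : ℝ))) *
          ((nCol N : ℝ) * (8 * P.d / δ) ^ P.d * ((P.L : ℝ) ^ k) ^ P.d *
            Real.exp (-(δ / 2 * (P.mesh k)⁻¹ * (P.mesh 0 * (HiggsLattice.Site.tdist x y : ℝ))))) :=
        mul_le_mul_of_nonneg_left hconv hm
    _ = (c₁ * c₂ * ((nCol N : ℝ) * (8 * P.d / δ) ^ P.d)) *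
          (P.mesh k ^ (a₁ - (P.d : ℝ)) * P.mesh k ^ (a₂ - (P.d : ℝ)) * ((P.L : ℝ) ^ k) ^ P.d) *
          Real.exp (-(δ / 2 * (P.mesh k)⁻¹ * (P.mesh 0 * (HiggsLattice.Site.tdist x y : ℝ)))) := by ring
    _ = top P k (c₁ * c₂ * pairC P N δ) (a₁ + a₂) (δ / 2) x y := by
        rw [top_scale_algebra, top, pairC]; ring

/-- **Two top bumps contracted over the BONDS of `T_ε`** (majorants read at `b₋`; bonds = sites × `d` directions):
`Σ_b F(b)G(b) ≤ top_k(d·c₁c₂·pairC(δ), a₁+a₂; δ/2)(x,y)`. [cite: Balaban1983Higgs3, (2.6) p.424, (2.10) p.426] [cite: Balaban1982Higgs1, (1.4) p.604] -/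
theorem sum_bond_top_mul_top_le {k : ℕ} {δ : ℝ} (hδ : 0 < δ) (hδ1 : δ ≤ 1) {a₁ a₂ c₁ c₂ : ℝ} (hc₁ : 0 ≤ c₁) (hc₂ : 0 ≤ c₂)
    (i₀ : Ix N) (x y : HiggsLattice.Site P 0) (F G : HiggsLattice.PBond P 0 → ℝ) (hF0 : ∀ b, 0 ≤ F b) (hG0 : ∀ b, 0 ≤ G b)
    (hF : ∀ b, F b ≤ top P k c₁ a₁ δ x b.src) (hG : ∀ b, G b ≤ top P k c₂ a₂ δ b.src y) :
    ∑ b : HiggsLattice.PBond P 0, F b * G b ≤ top P k ((P.d : ℝ) * (c₁ * c₂ * pairC P N δ)) (a₁ + a₂) (δ / 2) x y := by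
  set M₁ : HiggsLattice.Site P 0 → ℝ := fun u => top P k c₁ a₁ δ x u with hM₁
  set M₂ : HiggsLattice.Site P 0 → ℝ := fun u => top P k c₂ a₂ δ u y with hM₂
  have hsd := sum_site_dir (P := P) (k := 0) (fun u (_μ : Fin P.d) => M₁ u * M₂ u)
  have hd : ∑ u : HiggsLattice.Site P 0, ∑ _μ : Fin P.d, M₁ u * M₂ u
      = (P.d : ℝ) * ∑ u : HiggsLattice.Site P 0, M₁ u * M₂ u := by
    rw [Finset.mul_sum]
    refine Finset.sum_congr rfl fun u _ => ?_
    simp only [Finset.sum_const, Finset.card_univ, Fintype.card_fin, nsmul_eq_mul]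
  calc ∑ b : HiggsLattice.PBond P 0, F b * G b
      ≤ ∑ b : HiggsLattice.PBond P 0, M₁ b.src * M₂ b.src :=
        Finset.sum_le_sum fun b _ => mul_le_mul (hF b) (hG b) (hG0 b) ((hF0 b).trans (hF b))
    _ = (P.d : ℝ) * ∑ u : HiggsLattice.Site P 0, M₁ u * M₂ u := by rw [← hsd, hd]
    _ ≤ (P.d : ℝ) * top P k (c₁ * c₂ * pairC P N δ) (a₁ + a₂) (δ / 2) x y := by
        refine mul_le_mul_of_nonneg_left ?_ (Nat.cast_nonneg _)
        exact sum_top_mul_top_le hδ hδ1 hc₁ hc₂ i₀ x y M₁ M₂ (fun u => top_nonneg hc₁ x u) (fun u => top_nonneg hc₂ u y)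
          (fun u => le_rfl) (fun u => le_rfl)
    _ = _ := by rw [mul_top]

end TopSums

/-! ## §3 The far pairings: kernel from `p`, state from `x′`, sources far from both -/

section FarPairs

variable (hL2 : 2 ≤ P.L) {k : ℕ} {δ ρ : ℝ} (hδ : 0 < δ) (hδ1 : δ ≤ 1) (hρ : 1 ≤ ρ)
include hL2 hδ hδ1 hρ

/-- **Far pairing over SITES** (`a₁, a₂ ≥ 0`, `c₁, c₂ ≥ 0`): if `0 ≤ F(y) ≤ 𝔪_k(c₁,a₁;δ)(p,y)` and `0 ≤ G(y) ≤ 𝔪_k(c₂,a₂;δ)(y,x′)` on a finite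
set `S` of sources with `y` far from `p` AND from `x′`, then
`Σ_{y∈S} F(y)G(y) ≤ top_k(farF·c₁·(farC·c₂)·pairC(δ/2), a₁+a₂; δ/4)(p,x′)` (§1 on each leg, §2 at the top scale).
[cite: Balaban1983Higgs3, (1.16) p.414, (2.10) p.426, p.433] -/
theorem sum_far_pair_le {a₁ a₂ c₁ c₂ : ℝ} (ha₁ : 0 ≤ a₁) (ha₂ : 0 ≤ a₂) (hc₁ : 0 ≤ c₁) (hc₂ : 0 ≤ c₂) (i₀ : Ix N)
    (p x' : HiggsLattice.Site P 0) (S : Finset (HiggsLattice.Site P 0)) (F G : HiggsLattice.Site P 0 → ℝ)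
    (hF0 : ∀ y, 0 ≤ F y) (hG0 : ∀ y, 0 ≤ G y)
    (hF : ∀ y ∈ S, F y ≤ maj P k c₁ a₁ δ p y) (hG : ∀ y ∈ S, G y ≤ maj P k c₂ a₂ δ y x')
    (hfar : ∀ y ∈ S, Far P k ρ p y ∧ Far P k ρ y x') :
    ∑ y ∈ S, F y * G y ≤ top P k (farF P δ ρ * c₁ * (farC P δ * c₂) * pairC P N (δ / 2)) (a₁ + a₂) (δ / 4) p x' := by
  classical
  have hfF : 0 ≤ farF P δ ρ := (farF_pos hδ ρ).le
  have hfC : 0 ≤ farC P δ := (farC_pos (P := P) hδ).le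
  have hρ0 : 0 ≤ ρ := zero_le_one.trans hρ
  set T₁ : HiggsLattice.Site P 0 → ℝ := fun y => top P k (farF P δ ρ * c₁) a₁ (δ / 2) p y with hT₁
  set T₂ : HiggsLattice.Site P 0 → ℝ := fun y => top P k (farC P δ * c₂) a₂ (δ / 2) y x' with hT₂
  -- on `S`: each factor below its top bump; off `S`: the indicator
  set F' : HiggsLattice.Site P 0 → ℝ := fun y => if y ∈ S then F y else 0 with hF'
  set G' : HiggsLattice.Site P 0 → ℝ := fun y => if y ∈ S then G y else 0 with hG'
  have hF'0 : ∀ y, 0 ≤ F' y := fun y => by simp only [hF']; split_ifs; exacts [hF0 y, le_rfl]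
  have hG'0 : ∀ y, 0 ≤ G' y := fun y => by simp only [hG']; split_ifs; exacts [hG0 y, le_rfl]
  have hF'le : ∀ y, F' y ≤ T₁ y := fun y => by
    simp only [hF', hT₁]; split_ifs with hy
    · exact (hF y hy).trans (maj_far_le_top hL2 hc₁ ha₁ hδ hρ (hfar y hy).1)
    · exact top_nonneg (mul_nonneg hfF hc₁) p y
  have hG'le : ∀ y, G' y ≤ T₂ y := fun y => by
    simp only [hG', hT₂]; split_ifs with hy
    · refine (hG y hy).trans ((maj_far_le_top hL2 hc₂ ha₂ hδ hρ (hfar y hy).2).trans ?_)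
      exact top_const_mono (mul_le_mul_of_nonneg_right (farF_le_farC hδ hρ0) hc₂) y x'
    · exact top_nonneg (mul_nonneg hfC hc₂) y x'
  have hsum : ∑ y ∈ S, F y * G y = ∑ y ∈ S, F' y * G' y :=
    Finset.sum_congr rfl fun y hy => by simp only [hF', hG', if_pos hy]
  rw [hsum]
  have hδ2 : 0 < δ / 2 := by positivity
  have hδ21 : δ / 2 ≤ 1 := by linarith
  calc ∑ y ∈ S, F' y * G' y ≤ ∑ y : HiggsLattice.Site P 0, F' y * G' y :=
        Finset.sum_le_univ_sum_of_nonneg fun y => mul_nonneg (hF'0 y) (hG'0 y)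
    _ ≤ top P k (farF P δ ρ * c₁ * (farC P δ * c₂) * pairC P N (δ / 2)) (a₁ + a₂) (δ / 2 / 2) p x' :=
        sum_top_mul_top_le hδ2 hδ21 (mul_nonneg hfF hc₁) (mul_nonneg hfC hc₂) i₀ p x' F' G' hF'0 hG'0 hF'le hG'le
    _ = _ := by rw [show δ / 2 / 2 = δ / 4 by ring]

/-- **Far pairing over BONDS** (majorants read at `b₋`; the caller moves `b₊`-readings to `b₋` by `maj_shift_right`/`maj_shift_left`):
`Σ_{b∈S} F(b)G(b) ≤ top_k(d·farF·c₁·(farC·c₂)·pairC(δ/2), a₁+a₂; δ/4)(p,x′)` for bonds whose base point is far from `p` and from `x′`.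
[cite: Balaban1983Higgs3, (1.16) p.414, (2.10) p.426, p.433] [cite: Balaban1982Higgs1, (1.4) p.604] -/
theorem sum_bond_far_pair_le {a₁ a₂ c₁ c₂ : ℝ} (ha₁ : 0 ≤ a₁) (ha₂ : 0 ≤ a₂) (hc₁ : 0 ≤ c₁) (hc₂ : 0 ≤ c₂) (i₀ : Ix N)
    (p x' : HiggsLattice.Site P 0) (S : Finset (HiggsLattice.PBond P 0)) (F G : HiggsLattice.PBond P 0 → ℝ)
    (hF0 : ∀ b, 0 ≤ F b) (hG0 : ∀ b, 0 ≤ G b)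
    (hF : ∀ b ∈ S, F b ≤ maj P k c₁ a₁ δ p b.src) (hG : ∀ b ∈ S, G b ≤ maj P k c₂ a₂ δ b.src x')
    (hfar : ∀ b ∈ S, Far P k ρ p b.src ∧ Far P k ρ b.src x') :
    ∑ b ∈ S, F b * G b
      ≤ top P k ((P.d : ℝ) * (farF P δ ρ * c₁ * (farC P δ * c₂) * pairC P N (δ / 2))) (a₁ + a₂) (δ / 4) p x' := by
  classical
  have hfF : 0 ≤ farF P δ ρ := (farF_pos hδ ρ).le
  have hfC : 0 ≤ farC P δ := (farC_pos (P := P) hδ).le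
  have hρ0 : 0 ≤ ρ := zero_le_one.trans hρ
  set T₁ : HiggsLattice.Site P 0 → ℝ := fun y => top P k (farF P δ ρ * c₁) a₁ (δ / 2) p y with hT₁
  set T₂ : HiggsLattice.Site P 0 → ℝ := fun y => top P k (farC P δ * c₂) a₂ (δ / 2) y x' with hT₂
  set F' : HiggsLattice.PBond P 0 → ℝ := fun b => if b ∈ S then F b else 0 with hF'
  set G' : HiggsLattice.PBond P 0 → ℝ := fun b => if b ∈ S then G b else 0 with hG'
  have hF'0 : ∀ b, 0 ≤ F' b := fun b => by simp only [hF']; split_ifs; exacts [hF0 b, le_rfl]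
  have hG'0 : ∀ b, 0 ≤ G' b := fun b => by simp only [hG']; split_ifs; exacts [hG0 b, le_rfl]
  have hF'le : ∀ b, F' b ≤ T₁ b.src := fun b => by
    simp only [hF', hT₁]; split_ifs with hb
    · exact (hF b hb).trans (maj_far_le_top hL2 hc₁ ha₁ hδ hρ (hfar b hb).1)
    · exact top_nonneg (mul_nonneg hfF hc₁) p b.src
  have hG'le : ∀ b, G' b ≤ T₂ b.src := fun b => by
    simp only [hG', hT₂]; split_ifs with hb
    · refine (hG b hb).trans ((maj_far_le_top hL2 hc₂ ha₂ hδ hρ (hfar b hb).2).trans ?_)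
      exact top_const_mono (mul_le_mul_of_nonneg_right (farF_le_farC hδ hρ0) hc₂) b.src x'
    · exact top_nonneg (mul_nonneg hfC hc₂) b.src x'
  have hsum : ∑ b ∈ S, F b * G b = ∑ b ∈ S, F' b * G' b :=
    Finset.sum_congr rfl fun b hb => by simp only [hF', hG', if_pos hb]
  rw [hsum]
  have hδ2 : 0 < δ / 2 := by positivity
  have hδ21 : δ / 2 ≤ 1 := by linarith
  calc ∑ b ∈ S, F' b * G' b ≤ ∑ b : HiggsLattice.PBond P 0, F' b * G' b :=
        Finset.sum_le_univ_sum_of_nonneg fun b => mul_nonneg (hF'0 b) (hG'0 b)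
    _ ≤ top P k ((P.d : ℝ) * (farF P δ ρ * c₁ * (farC P δ * c₂) * pairC P N (δ / 2))) (a₁ + a₂) (δ / 2 / 2) p x' :=
        sum_bond_top_mul_top_le hδ2 hδ21 (mul_nonneg hfF hc₁) (mul_nonneg hfC hc₂) i₀ p x' F' G' hF'0 hG'0 hF'le hG'le
    _ = _ := by rw [show δ / 2 / 2 = δ / 4 by ring]

/-- **Far pairing of a kernel with BLOCK-AVERAGED states** (the averaging sources of `V_k`): for block sites `z` far from `p`,
`Σ_{z∈S} K(z)·L^{−kd}Σ_{u∈B^k(z̄)}V(u) ≤ top_k(farF·c_K·(blkK·c_v)·pairC(δ/2), a_K + a_v; δ/4)(p,x′)` (`a_K ≥ 0`, `a_v > 0`, `k ≤ K`; the block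
average of a majorant is a top bump, p35's `block_avg_maj_le`; the kernel leg is far).
[cite: Balaban1982Higgs1, (3.15)–(3.16) pp.614–615] [cite: Balaban1983Higgs3, (1.16) p.414, (2.10) p.426, p.433] -/
theorem sum_far_avg_le (hkK : k ≤ P.K) {aK av cK cv : ℝ} (haK : 0 ≤ aK) (hav : 0 < av) (hcK : 0 ≤ cK) (hcv : 0 ≤ cv)
    (i₀ : Ix N) (p x' : HiggsLattice.Site P 0) (S : Finset (HiggsLattice.Site P 0)) (K V : HiggsLattice.Site P 0 → ℝ)
    (hK0 : ∀ z, 0 ≤ K z) (hV0 : ∀ u, 0 ≤ V u)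
    (hK : ∀ z ∈ S, K z ≤ maj P k cK aK δ p z) (hV : ∀ u, V u ≤ maj P k cv av δ u x') (hfar : ∀ z ∈ S, Far P k ρ p z) :
    ∑ z ∈ S, K z * (((P.L : ℝ) ^ (k * P.d))⁻¹ * ∑ u ∈ blockK k (blockIter k z), V u)
      ≤ top P k (farF P δ ρ * cK * (blkK P N δ av * cv) * pairC P N (δ / 2)) (aK + av) (δ / 4) p x' := by
  classical
  have hL1 : 1 < P.L := lt_of_lt_of_le one_lt_two hL2
  have hL0 : (0 : ℝ) ≤ (P.L : ℝ) := Nat.cast_nonneg _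
  have hfF : 0 ≤ farF P δ ρ := (farF_pos hδ ρ).le
  have hbk : 0 ≤ blkK P N δ av * cv := mul_nonneg (blkK_nonneg hL1 hδ hav) hcv
  set T₁ : HiggsLattice.Site P 0 → ℝ := fun z => top P k (farF P δ ρ * cK) aK (δ / 2) p z with hT₁
  set T₂ : HiggsLattice.Site P 0 → ℝ := fun z => top P k (blkK P N δ av * cv) av (δ / 2) z x' with hT₂
  set A : HiggsLattice.Site P 0 → ℝ := fun z => ((P.L : ℝ) ^ (k * P.d))⁻¹ * ∑ u ∈ blockK k (blockIter k z), V u with hA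
  have hA0 : ∀ z, 0 ≤ A z := fun z =>
    mul_nonneg (inv_nonneg.mpr (pow_nonneg hL0 _)) (Finset.sum_nonneg fun u _ => hV0 u)
  have hAle : ∀ z, A z ≤ T₂ z := fun z => by
    refine le_trans (mul_le_mul_of_nonneg_left (Finset.sum_le_sum fun u _ => hV u) (inv_nonneg.mpr (pow_nonneg hL0 _))) ?_
    refine (block_avg_maj_le hL1 hkK hδ hδ1 hcv hav i₀ z x').trans (le_of_eq ?_)
    simp only [hT₂, top]
  set K' : HiggsLattice.Site P 0 → ℝ := fun z => if z ∈ S then K z else 0 with hK'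
  have hK'0 : ∀ z, 0 ≤ K' z := fun z => by simp only [hK']; split_ifs; exacts [hK0 z, le_rfl]
  have hK'le : ∀ z, K' z ≤ T₁ z := fun z => by
    simp only [hK', hT₁]; split_ifs with hz
    · exact (hK z hz).trans (maj_far_le_top hL2 hcK haK hδ hρ (hfar z hz))
    · exact top_nonneg (mul_nonneg hfF hcK) p z
  have hsum : ∑ z ∈ S, K z * A z = ∑ z ∈ S, K' z * A z :=
    Finset.sum_congr rfl fun z hz => by simp only [hK', if_pos hz]
  change ∑ z ∈ S, K z * A z ≤ _
  rw [hsum]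
  have hδ2 : 0 < δ / 2 := by positivity
  have hδ21 : δ / 2 ≤ 1 := by linarith
  calc ∑ z ∈ S, K' z * A z ≤ ∑ z : HiggsLattice.Site P 0, K' z * A z :=
        Finset.sum_le_univ_sum_of_nonneg fun z => mul_nonneg (hK'0 z) (hA0 z)
    _ ≤ top P k (farF P δ ρ * cK * (blkK P N δ av * cv) * pairC P N (δ / 2)) (aK + av) (δ / 2 / 2) p x' :=
        sum_top_mul_top_le hδ2 hδ21 (mul_nonneg hfF hcK) hbk i₀ p x' K' A hK'0 hA0 hK'le hAle
    _ = _ := by rw [show δ / 2 / 2 = δ / 4 by ring]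

end FarPairs

/-! ## §4 The collar row: every source far from the evaluation point and from the test source -/

section CollarRow

/-- the constant of the collar row (explicit; every factor displayed; the seven terms in the order of `collar_row_le`).
[cite: Balaban1983Higgs3, (1.16) p.414, (2.10) p.426, p.433] -/
def collarC (P : HiggsLattice.Params) (N : ℕ) (k : ℕ) (δ aK aKd av cK cKd cv cd κ₁ κ₂ κ₃ κ₅ κF κ₄ : ℝ) : ℝ :=
  (P.d : ℝ) * (κ₁ * (Real.exp 1 * cK) * (farC P δ * cd) * pairC P N (δ / 2))
    + P.mesh k * ((P.d : ℝ) * (κ₂ * cK * (farC P δ * cv) * pairC P N (δ / 2)))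
    + (P.d : ℝ) * (κ₁ * cK * (farC P δ * cd) * pairC P N (δ / 2))
    + P.mesh k * ((P.d : ℝ) * (κ₃ * (Real.exp 1 * cK) * (farC P δ * (Real.exp 1 * cv)) * pairC P N (δ / 2)))
    + P.mesh k ^ (aKd + 1 - aK) * ((P.d : ℝ) * (κ₅ * cKd * (farC P δ * (Real.exp 1 * cv)) * pairC P N (δ / 2)))
    + P.mesh k * (κF * cK * (farC P δ * cv) * pairC P N (δ / 2))
    + P.mesh k * (κ₄ * cK * (blkK P N δ av * cv) * pairC P N (δ / 2))

/-- `collarC ≥ 0` (all its factors are nonnegative: `δ > 0`, `a_v > 0`, `L > 1`). [cite: Balaban1983Higgs3, (2.10) p.426] -/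
theorem collarC_nonneg (hL : 1 < P.L) (k : ℕ) {δ aK aKd av cK cKd cv cd κ₁ κ₂ κ₃ κ₅ κF κ₄ : ℝ} (hδ : 0 < δ) (hav : 0 < av)
    (hcK : 0 ≤ cK) (hcKd : 0 ≤ cKd) (hcv : 0 ≤ cv) (hcd : 0 ≤ cd)
    (hκ₁ : 0 ≤ κ₁) (hκ₂ : 0 ≤ κ₂) (hκ₃ : 0 ≤ κ₃) (hκ₅ : 0 ≤ κ₅) (hκF : 0 ≤ κF) (hκ₄ : 0 ≤ κ₄) :
    0 ≤ collarC P N k δ aK aKd av cK cKd cv cd κ₁ κ₂ κ₃ κ₅ κF κ₄ := by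
  have h1 : 0 ≤ farC P δ := (farC_pos (P := P) hδ).le
  have h2 : 0 ≤ pairC P N (δ / 2) := pairC_nonneg (by positivity)
  have h3 : 0 ≤ blkK P N δ av := blkK_nonneg hL hδ hav
  have h4 : 0 ≤ P.mesh k := (P.mesh_pos k).le
  have h5 : 0 ≤ Real.exp 1 := Real.exp_nonneg _
  have h6 : 0 ≤ P.mesh k ^ (aKd + 1 - aK) := Real.rpow_nonneg h4 _
  unfold collarC
  positivity

/-- **THE COLLAR ROW.**  Let `K ≥ 0` be a row kernel majorised from the evaluation point `p`
(`a_K ≥ 0`, `K ≤ 𝔪_k(c_K,a_K;δ)(p,·)`: the column of `T₀`), `K^D ≥ 0` its differentiated companion on the source bonds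
(`K^D(b) ≤ 𝔪_k(c,a^D;δ)(b₋,p)`, `a^D ≥ 0` — for the symmetric reading of the `D^{ε*}M` source `a^D = a_K − 1`, the derivative at `b` of the row `p` of `T₀`;
its term is brought to the common exponent by the exact factor `(L^kε)^{a^D+1−a_K}`), `V ≥ 0` the
values of the state `w` majorised from the test source `x′` with exponent `a_v ≥ 1` and `D ≥ 0` its covariant derivatives on the source bonds
(exponent `a_v − 1`), all at the rate `0 < δ ≤ 1`; let the bond sources `S`, the site sources `S_y` (the face legs of a box) be FAR from `p`
and from `x′`, and the block sources `S_z` far from `p` (`ρ ≥ 1`, `L ≥ 2`, `k ≤ K`).  Then for all `κ ≥ 0`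
`Σ_{b∈S}[κ₁D(b)K(b₊) + (κ₂V(b₋) + κ₁D(b))K(b₋) + κ₃V(b₊)K(b₊) + κ₅V(b₊)K^D(b)] + κ_FΣ_{y∈S_y}V(y)K(y) + κ₄Σ_{z∈S_z}K(z)L^{−kd}Σ_{u∈B^k(z̄)}V(u)
≤ top_k(farF(δ,ρ)·collarC, a_K + a_v − 1; δ/4)(p, x′)` — the input shape of r14's symmetric rows `B3Op116SourceForm.norm_propagatorK_srcV_apply_le`
(`κ₁ = κ₅ = |e|s`, `κ₂ = 0`, `κ₃ = (|e|s)²`, `κ₄ = |a_k|(L^kε)^{−2}m(2+m)`) and of p35's Leibniz rows with the face term of a box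
(`κ₂ = ε^{−1}|e|δ_P`, `κ_F = 2dε^{−1}|e|s`), exponentially small in the margin `ρ` and a single top-scale bump (no logarithm in `k`).
[cite: Balaban1983Higgs3, (1.16) p.414, (2.6) p.424, (2.10) p.426, p.433] [cite: Balaban1982Higgs1, (3.16) p.615] -/
theorem collar_row_le (hL2 : 2 ≤ P.L) {k : ℕ} (hkK : k ≤ P.K) {δ ρ : ℝ} (hδ : 0 < δ) (hδ1 : δ ≤ 1) (hρ : 1 ≤ ρ)
    {aK aKd av cK cKd cv cd κ₁ κ₂ κ₃ κ₅ κF κ₄ : ℝ} (haK : 0 ≤ aK) (haKd : 0 ≤ aKd) (hav : 1 ≤ av)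
    (hcK : 0 ≤ cK) (hcKd : 0 ≤ cKd) (hcv : 0 ≤ cv) (hcd : 0 ≤ cd)
    (hκ₁ : 0 ≤ κ₁) (hκ₂ : 0 ≤ κ₂) (hκ₃ : 0 ≤ κ₃) (hκ₅ : 0 ≤ κ₅) (hκF : 0 ≤ κF) (hκ₄ : 0 ≤ κ₄)
    (i₀ : Ix N) (p x' : HiggsLattice.Site P 0) (S : Finset (HiggsLattice.PBond P 0)) (Sy Sz : Finset (HiggsLattice.Site P 0))
    (K : HiggsLattice.Site P 0 → ℝ) (hK0 : ∀ y, 0 ≤ K y) (hK : ∀ y, K y ≤ maj P k cK aK δ p y)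
    (Kd : HiggsLattice.PBond P 0 → ℝ) (hKd0 : ∀ b, 0 ≤ Kd b) (hKd : ∀ b ∈ S, Kd b ≤ maj P k cKd aKd δ b.src p)
    (V : HiggsLattice.Site P 0 → ℝ) (hV0 : ∀ u, 0 ≤ V u) (hV : ∀ u, V u ≤ maj P k cv av δ u x')
    (D : HiggsLattice.PBond P 0 → ℝ) (hD0 : ∀ b, 0 ≤ D b) (hD : ∀ b ∈ S, D b ≤ maj P k cd (av - 1) δ b.src x')
    (hS : ∀ b ∈ S, Far P k ρ p b.src ∧ Far P k ρ b.src x')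
    (hSy : ∀ y ∈ Sy, Far P k ρ p y ∧ Far P k ρ y x') (hSz : ∀ z ∈ Sz, Far P k ρ p z) :
    (∑ b ∈ S, (κ₁ * D b * K b.tgt + (κ₂ * V b.src + κ₁ * D b) * K b.src + κ₃ * V b.tgt * K b.tgt + κ₅ * V b.tgt * Kd b))
      + κF * ∑ y ∈ Sy, V y * K y
      + κ₄ * ∑ z ∈ Sz, K z * (((P.L : ℝ) ^ (k * P.d))⁻¹ * ∑ u ∈ blockK k (blockIter k z), V u)
      ≤ top P k (farF P δ ρ * collarC P N k δ aK aKd av cK cKd cv cd κ₁ κ₂ κ₃ κ₅ κF κ₄) (aK + av - 1) (δ / 4) p x' := by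
  have hav0 : 0 < av := lt_of_lt_of_le zero_lt_one hav
  have hav1 : 0 ≤ av - 1 := by linarith
  have haK0 : 0 ≤ aK := haK
  have e0 : 0 ≤ Real.exp 1 := Real.exp_nonneg _
  have hecK : 0 ≤ Real.exp 1 * cK := mul_nonneg e0 hcK
  have hecv : 0 ≤ Real.exp 1 * cv := mul_nonneg e0 hcv
  -- readings at `b₊` moved to `b₋`
  have hKt : ∀ b ∈ S, K b.tgt ≤ maj P k (Real.exp 1 * cK) aK δ p b.src := fun b _ =>
    (hK b.tgt).trans (maj_shift_right hδ hδ1 hcK p b.src b.dir)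
  have hVt : ∀ b ∈ S, V b.tgt ≤ maj P k (Real.exp 1 * cv) av δ b.src x' := fun b _ =>
    (hV b.tgt).trans (maj_shift_left hδ hδ1 hcv b.src x' b.dir)
  have hKdp : ∀ b ∈ S, Kd b ≤ maj P k cKd aKd δ p b.src := fun b hb => by
    rw [B3Op116MajorantStep.maj_comm]; exact hKd b hb
  -- the seven terms
  have t1 : ∑ b ∈ S, κ₁ * D b * K b.tgt
      ≤ top P k ((P.d : ℝ) * (κ₁ * (farF P δ ρ * (Real.exp 1 * cK) * (farC P δ * cd) * pairC P N (δ / 2))))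
          (aK + av - 1) (δ / 4) p x' := by
    have h := sum_bond_far_pair_le hL2 hδ hδ1 hρ haK0 hav1 hecK hcd i₀ p x' S (fun b => K b.tgt) D (fun b => hK0 _) hD0 hKt hD hS
    rw [show aK + (av - 1) = aK + av - 1 by ring] at h
    calc ∑ b ∈ S, κ₁ * D b * K b.tgt = κ₁ * ∑ b ∈ S, K b.tgt * D b := by
          rw [Finset.mul_sum]; exact Finset.sum_congr rfl fun b _ => by ring
      _ ≤ κ₁ * top P k ((P.d : ℝ) * (farF P δ ρ * (Real.exp 1 * cK) * (farC P δ * cd) * pairC P N (δ / 2))) (aK + av - 1) (δ / 4) p x' :=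
          mul_le_mul_of_nonneg_left h hκ₁
      _ = _ := by rw [mul_top]; ring_nf
  have t2 : ∑ b ∈ S, κ₂ * V b.src * K b.src
      ≤ top P k (P.mesh k * ((P.d : ℝ) * (κ₂ * (farF P δ ρ * cK * (farC P δ * cv) * pairC P N (δ / 2)))))
          (aK + av - 1) (δ / 4) p x' := by
    have h := sum_bond_far_pair_le hL2 hδ hδ1 hρ haK0 hav0.le hcK hcv i₀ p x' S (fun b => K b.src) (fun b => V b.src)
      (fun b => hK0 _) (fun b => hV0 _) (fun b _ => hK b.src) (fun b _ => hV b.src) hS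
    rw [show aK + av = (aK + av - 1) + 1 by ring, top_exponent_succ] at h
    calc ∑ b ∈ S, κ₂ * V b.src * K b.src = κ₂ * ∑ b ∈ S, K b.src * V b.src := by
          rw [Finset.mul_sum]; exact Finset.sum_congr rfl fun b _ => by ring
      _ ≤ κ₂ * top P k ((P.d : ℝ) * (farF P δ ρ * cK * (farC P δ * cv) * pairC P N (δ / 2)) * P.mesh k) (aK + av - 1) (δ / 4) p x' :=
          mul_le_mul_of_nonneg_left h hκ₂
      _ = _ := by rw [mul_top]; ring_nf
  have t3 : ∑ b ∈ S, κ₁ * D b * K b.src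
      ≤ top P k ((P.d : ℝ) * (κ₁ * (farF P δ ρ * cK * (farC P δ * cd) * pairC P N (δ / 2))))
          (aK + av - 1) (δ / 4) p x' := by
    have h := sum_bond_far_pair_le hL2 hδ hδ1 hρ haK0 hav1 hcK hcd i₀ p x' S (fun b => K b.src) D (fun b => hK0 _) hD0
      (fun b _ => hK b.src) hD hS
    rw [show aK + (av - 1) = aK + av - 1 by ring] at h
    calc ∑ b ∈ S, κ₁ * D b * K b.src = κ₁ * ∑ b ∈ S, K b.src * D b := by
          rw [Finset.mul_sum]; exact Finset.sum_congr rfl fun b _ => by ring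
      _ ≤ κ₁ * top P k ((P.d : ℝ) * (farF P δ ρ * cK * (farC P δ * cd) * pairC P N (δ / 2))) (aK + av - 1) (δ / 4) p x' :=
          mul_le_mul_of_nonneg_left h hκ₁
      _ = _ := by rw [mul_top]; ring_nf
  have t4 : ∑ b ∈ S, κ₃ * V b.tgt * K b.tgt
      ≤ top P k (P.mesh k * ((P.d : ℝ) * (κ₃ * (farF P δ ρ * (Real.exp 1 * cK) * (farC P δ * (Real.exp 1 * cv)) * pairC P N (δ / 2)))))
          (aK + av - 1) (δ / 4) p x' := by
    have h := sum_bond_far_pair_le hL2 hδ hδ1 hρ haK0 hav0.le hecK hecv i₀ p x' S (fun b => K b.tgt) (fun b => V b.tgt)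
      (fun b => hK0 _) (fun b => hV0 _) hKt hVt hS
    rw [show aK + av = (aK + av - 1) + 1 by ring, top_exponent_succ] at h
    calc ∑ b ∈ S, κ₃ * V b.tgt * K b.tgt = κ₃ * ∑ b ∈ S, K b.tgt * V b.tgt := by
          rw [Finset.mul_sum]; exact Finset.sum_congr rfl fun b _ => by ring
      _ ≤ κ₃ * top P k ((P.d : ℝ) * (farF P δ ρ * (Real.exp 1 * cK) * (farC P δ * (Real.exp 1 * cv)) * pairC P N (δ / 2)) * P.mesh k)
            (aK + av - 1) (δ / 4) p x' := mul_le_mul_of_nonneg_left h hκ₃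
      _ = _ := by rw [mul_top]; ring_nf
  have t5 : ∑ b ∈ S, κ₅ * V b.tgt * Kd b
      ≤ top P k (P.mesh k ^ (aKd + 1 - aK) *
            ((P.d : ℝ) * (κ₅ * (farF P δ ρ * cKd * (farC P δ * (Real.exp 1 * cv)) * pairC P N (δ / 2)))))
          (aK + av - 1) (δ / 4) p x' := by
    have h := sum_bond_far_pair_le hL2 hδ hδ1 hρ haKd hav0.le hcKd hecv i₀ p x' S Kd (fun b => V b.tgt) hKd0 (fun b => hV0 _)
      hKdp hVt hS
    rw [top_exponent k _ (aKd + av) (aK + av - 1), show aKd + av - (aK + av - 1) = aKd + 1 - aK by ring] at h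
    calc ∑ b ∈ S, κ₅ * V b.tgt * Kd b = κ₅ * ∑ b ∈ S, Kd b * V b.tgt := by
          rw [Finset.mul_sum]; exact Finset.sum_congr rfl fun b _ => by ring
      _ ≤ κ₅ * top P k ((P.d : ℝ) * (farF P δ ρ * cKd * (farC P δ * (Real.exp 1 * cv)) * pairC P N (δ / 2))
            * P.mesh k ^ (aKd + 1 - aK)) (aK + av - 1) (δ / 4) p x' := mul_le_mul_of_nonneg_left h hκ₅
      _ = _ := by rw [mul_top]; ring_nf
  have t6 : κF * ∑ y ∈ Sy, V y * K y
      ≤ top P k (P.mesh k * (κF * (farF P δ ρ * cK * (farC P δ * cv) * pairC P N (δ / 2)))) (aK + av - 1) (δ / 4) p x' := by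
    have h := sum_far_pair_le hL2 hδ hδ1 hρ haK0 hav0.le hcK hcv i₀ p x' Sy K V hK0 hV0 (fun y _ => hK y) (fun y _ => hV y) hSy
    rw [show aK + av = (aK + av - 1) + 1 by ring, top_exponent_succ] at h
    calc κF * ∑ y ∈ Sy, V y * K y = κF * ∑ y ∈ Sy, K y * V y := by
          congr 1; exact Finset.sum_congr rfl fun y _ => by ring
      _ ≤ κF * top P k (farF P δ ρ * cK * (farC P δ * cv) * pairC P N (δ / 2) * P.mesh k) (aK + av - 1) (δ / 4) p x' :=
          mul_le_mul_of_nonneg_left h hκF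
      _ = _ := by rw [mul_top]; ring_nf
  have t7 : κ₄ * ∑ z ∈ Sz, K z * (((P.L : ℝ) ^ (k * P.d))⁻¹ * ∑ u ∈ blockK k (blockIter k z), V u)
      ≤ top P k (P.mesh k * (κ₄ * (farF P δ ρ * cK * (blkK P N δ av * cv) * pairC P N (δ / 2)))) (aK + av - 1) (δ / 4) p x' := by
    have h := sum_far_avg_le hL2 hδ hδ1 hρ hkK haK0 hav0 hcK hcv i₀ p x' Sz K V hK0 hV0 (fun z _ => hK z) hV hSz
    rw [show aK + av = (aK + av - 1) + 1 by ring, top_exponent_succ] at h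
    refine (mul_le_mul_of_nonneg_left h hκ₄).trans (le_of_eq ?_)
    rw [mul_top]; ring_nf
  -- split the bond sum and add up
  have hsplit : ∑ b ∈ S, (κ₁ * D b * K b.tgt + (κ₂ * V b.src + κ₁ * D b) * K b.src + κ₃ * V b.tgt * K b.tgt + κ₅ * V b.tgt * Kd b)
      = ∑ b ∈ S, κ₁ * D b * K b.tgt + ∑ b ∈ S, κ₂ * V b.src * K b.src + ∑ b ∈ S, κ₁ * D b * K b.src
        + ∑ b ∈ S, κ₃ * V b.tgt * K b.tgt + ∑ b ∈ S, κ₅ * V b.tgt * Kd b := by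
    simp only [← Finset.sum_add_distrib]
    exact Finset.sum_congr rfl fun b _ => by ring
  rw [hsplit]
  refine (add_le_add (add_le_add (add_le_add (add_le_add (add_le_add (add_le_add t1 t2) t3) t4) t5) t6) t7).trans (le_of_eq ?_)
  simp only [top_add]
  simp only [top]
  unfold collarC farF
  ring

/-- **THE COLLAR ROW WITH A TWO-ANCHOR KERNEL** (the Hölder-transported differentiated row, p35's `hcol_le_of_pieces` shape: the
kernel is majorised by the SUM of the one-anchor majorants from `p₁` and from `p₂`, exponent `a_K = 1 − α ≥ 0`; no `K^D` term): the same
row is `≤ top_k(farF·collarC, a_K + a_v − 1; δ/4)(p₁,x′) + top_k(farF·collarC, a_K + a_v − 1; δ/4)(p₂,x′)` when every source is far from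
`p₁`, from `p₂` and from `x′` (linearity in `K` + `collar_row_le` twice). [cite: Balaban1983Higgs3, (1.16) p.414, (2.11) p.426, p.433] [cite: Balaban1982Higgs1, (3.16) p.615] -/
theorem collar_row_two_le (hL2 : 2 ≤ P.L) {k : ℕ} (hkK : k ≤ P.K) {δ ρ : ℝ} (hδ : 0 < δ) (hδ1 : δ ≤ 1) (hρ : 1 ≤ ρ)
    {aK av cK cv cd κ₁ κ₂ κ₃ κF κ₄ : ℝ} (haK : 0 ≤ aK) (hav : 1 ≤ av)
    (hcK : 0 ≤ cK) (hcv : 0 ≤ cv) (hcd : 0 ≤ cd) (hκ₁ : 0 ≤ κ₁) (hκ₂ : 0 ≤ κ₂) (hκ₃ : 0 ≤ κ₃) (hκF : 0 ≤ κF) (hκ₄ : 0 ≤ κ₄)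
    (i₀ : Ix N) (p₁ p₂ x' : HiggsLattice.Site P 0) (S : Finset (HiggsLattice.PBond P 0)) (Sy Sz : Finset (HiggsLattice.Site P 0))
    (K : HiggsLattice.Site P 0 → ℝ) (hK : ∀ y, K y ≤ maj P k cK aK δ p₁ y + maj P k cK aK δ p₂ y)
    (V : HiggsLattice.Site P 0 → ℝ) (hV0 : ∀ u, 0 ≤ V u) (hV : ∀ u, V u ≤ maj P k cv av δ u x')
    (D : HiggsLattice.PBond P 0 → ℝ) (hD0 : ∀ b, 0 ≤ D b) (hD : ∀ b ∈ S, D b ≤ maj P k cd (av - 1) δ b.src x')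
    (hS : ∀ b ∈ S, Far P k ρ p₁ b.src ∧ Far P k ρ p₂ b.src ∧ Far P k ρ b.src x')
    (hSy : ∀ y ∈ Sy, Far P k ρ p₁ y ∧ Far P k ρ p₂ y ∧ Far P k ρ y x') (hSz : ∀ z ∈ Sz, Far P k ρ p₁ z ∧ Far P k ρ p₂ z) :
    (∑ b ∈ S, (κ₁ * D b * K b.tgt + (κ₂ * V b.src + κ₁ * D b) * K b.src + κ₃ * V b.tgt * K b.tgt))
      + κF * ∑ y ∈ Sy, V y * K y
      + κ₄ * ∑ z ∈ Sz, K z * (((P.L : ℝ) ^ (k * P.d))⁻¹ * ∑ u ∈ blockK k (blockIter k z), V u)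
      ≤ top P k (farF P δ ρ * collarC P N k δ aK 0 av cK 0 cv cd κ₁ κ₂ κ₃ 0 κF κ₄) (aK + av - 1) (δ / 4) p₁ x'
        + top P k (farF P δ ρ * collarC P N k δ aK 0 av cK 0 cv cd κ₁ κ₂ κ₃ 0 κF κ₄) (aK + av - 1) (δ / 4) p₂ x' := by
  have hL0 : (0 : ℝ) ≤ (P.L : ℝ) := Nat.cast_nonneg _
  set M₁ : HiggsLattice.Site P 0 → ℝ := fun y => maj P k cK aK δ p₁ y with hM₁
  set M₂ : HiggsLattice.Site P 0 → ℝ := fun y => maj P k cK aK δ p₂ y with hM₂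
  have hM₁0 : ∀ y, 0 ≤ M₁ y := fun y => maj_nonneg hcK p₁ y
  have hM₂0 : ∀ y, 0 ≤ M₂ y := fun y => maj_nonneg hcK p₂ y
  have hKM : ∀ y, K y ≤ M₁ y + M₂ y := hK
  -- the row is monotone and additive in the kernel
  set row : (HiggsLattice.Site P 0 → ℝ) → ℝ := fun F =>
    (∑ b ∈ S, (κ₁ * D b * F b.tgt + (κ₂ * V b.src + κ₁ * D b) * F b.src + κ₃ * V b.tgt * F b.tgt + 0 * V b.tgt * (0 : ℝ)))
      + κF * ∑ y ∈ Sy, V y * F y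
      + κ₄ * ∑ z ∈ Sz, F z * (((P.L : ℝ) ^ (k * P.d))⁻¹ * ∑ u ∈ blockK k (blockIter k z), V u) with hrow
  have havg0 : ∀ z, 0 ≤ ((P.L : ℝ) ^ (k * P.d))⁻¹ * ∑ u ∈ blockK k (blockIter k z), V u := fun z =>
    mul_nonneg (inv_nonneg.mpr (pow_nonneg hL0 _)) (Finset.sum_nonneg fun u _ => hV0 u)
  have hmono : (∑ b ∈ S, (κ₁ * D b * K b.tgt + (κ₂ * V b.src + κ₁ * D b) * K b.src + κ₃ * V b.tgt * K b.tgt))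
      + κF * ∑ y ∈ Sy, V y * K y
      + κ₄ * ∑ z ∈ Sz, K z * (((P.L : ℝ) ^ (k * P.d))⁻¹ * ∑ u ∈ blockK k (blockIter k z), V u) ≤ row M₁ + row M₂ := by
    have hb : ∑ b ∈ S, (κ₁ * D b * K b.tgt + (κ₂ * V b.src + κ₁ * D b) * K b.src + κ₃ * V b.tgt * K b.tgt)
        ≤ ∑ b ∈ S, (κ₁ * D b * M₁ b.tgt + (κ₂ * V b.src + κ₁ * D b) * M₁ b.src + κ₃ * V b.tgt * M₁ b.tgt + 0 * V b.tgt * (0 : ℝ))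
          + ∑ b ∈ S, (κ₁ * D b * M₂ b.tgt + (κ₂ * V b.src + κ₁ * D b) * M₂ b.src + κ₃ * V b.tgt * M₂ b.tgt + 0 * V b.tgt * (0 : ℝ)) := by
      rw [← Finset.sum_add_distrib]
      refine Finset.sum_le_sum fun b _ => ?_
      have ht := hKM b.tgt
      have hs := hKM b.src
      have c1 : 0 ≤ κ₁ * D b := mul_nonneg hκ₁ (hD0 b)
      have c2 : 0 ≤ κ₂ * V b.src + κ₁ * D b := add_nonneg (mul_nonneg hκ₂ (hV0 _)) c1
      have c3 : 0 ≤ κ₃ * V b.tgt := mul_nonneg hκ₃ (hV0 _)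
      nlinarith [mul_le_mul_of_nonneg_left ht c1, mul_le_mul_of_nonneg_left hs c2, mul_le_mul_of_nonneg_left ht c3]
    have hy : κF * ∑ y ∈ Sy, V y * K y ≤ κF * ∑ y ∈ Sy, V y * M₁ y + κF * ∑ y ∈ Sy, V y * M₂ y := by
      rw [← mul_add, ← Finset.sum_add_distrib]
      refine mul_le_mul_of_nonneg_left (Finset.sum_le_sum fun y _ => ?_) hκF
      nlinarith [mul_le_mul_of_nonneg_left (hKM y) (hV0 y)]
    have hz : κ₄ * ∑ z ∈ Sz, K z * (((P.L : ℝ) ^ (k * P.d))⁻¹ * ∑ u ∈ blockK k (blockIter k z), V u)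
        ≤ κ₄ * ∑ z ∈ Sz, M₁ z * (((P.L : ℝ) ^ (k * P.d))⁻¹ * ∑ u ∈ blockK k (blockIter k z), V u)
          + κ₄ * ∑ z ∈ Sz, M₂ z * (((P.L : ℝ) ^ (k * P.d))⁻¹ * ∑ u ∈ blockK k (blockIter k z), V u) := by
      rw [← mul_add, ← Finset.sum_add_distrib]
      refine mul_le_mul_of_nonneg_left (Finset.sum_le_sum fun z _ => ?_) hκ₄
      nlinarith [mul_le_mul_of_nonneg_right (hKM z) (havg0 z)]
    simp only [hrow]
    linarith
  have hfar₁ : ∀ b ∈ S, Far P k ρ p₁ b.src ∧ Far P k ρ b.src x' := fun b hb => ⟨(hS b hb).1, (hS b hb).2.2⟩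
  have hfar₂ : ∀ b ∈ S, Far P k ρ p₂ b.src ∧ Far P k ρ b.src x' := fun b hb => ⟨(hS b hb).2.1, (hS b hb).2.2⟩
  have hfy₁ : ∀ y ∈ Sy, Far P k ρ p₁ y ∧ Far P k ρ y x' := fun y hy => ⟨(hSy y hy).1, (hSy y hy).2.2⟩
  have hfy₂ : ∀ y ∈ Sy, Far P k ρ p₂ y ∧ Far P k ρ y x' := fun y hy => ⟨(hSy y hy).2.1, (hSy y hy).2.2⟩
  have hKd : ∀ (q : HiggsLattice.Site P 0), ∀ b ∈ S, (fun _ : HiggsLattice.PBond P 0 => (0 : ℝ)) b ≤ maj P k 0 0 δ b.src q :=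
    fun q b _ => maj_nonneg le_rfl b.src q
  have h₁ := collar_row_le hL2 hkK hδ hδ1 hρ haK le_rfl hav hcK le_rfl hcv hcd hκ₁ hκ₂ hκ₃ le_rfl hκF hκ₄ i₀ p₁ x' S Sy Sz M₁ hM₁0
    (fun y => le_rfl) (fun _ => 0) (fun _ => le_rfl) (hKd p₁) V hV0 hV D hD0 hD hfar₁ hfy₁ (fun z hz => (hSz z hz).1)
  have h₂ := collar_row_le hL2 hkK hδ hδ1 hρ haK le_rfl hav hcK le_rfl hcv hcd hκ₁ hκ₂ hκ₃ le_rfl hκF hκ₄ i₀ p₂ x' S Sy Sz M₂ hM₂0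
    (fun y => le_rfl) (fun _ => 0) (fun _ => le_rfl) (hKd p₂) V hV0 hV D hD0 hD hfar₂ hfy₂ (fun z hz => (hSz z hz).2)
  exact hmono.trans (add_le_add h₁ h₂)

end CollarRow

/-! ## §5 (v1.1, append-only) The face pairings: sources on ONE lattice slice `{s : s_ν = c}` (a face of a box)

The face legs of a box (DESIGN-B3-116-box §1c: the entering/exiting bonds of `supp P` across `∂□` leave site charges `ε^{−1}|e|s‖w(y)‖` at face
sites) carry `ε^{−1}` on a VALUE state; summed with the `d`-dimensional volume of §2–§4 they would lose a factor `L^k`.  Summed over a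
`(d−1)`-dimensional slice (p35 g26's `B3Op116SliceSums.face_conv2_scales_le`: volume `(L^k)^{d−1}`) the top exponent drops by one and the
normalization improves by one `ε` — exactly compensating the `ε^{−1}` of the face charge.  A box has `2d` faces; the caller sums the slices. -/

section FacePairs

/-- the face pair constant at one scale, `faceC(δ) = (8d/δ)^{d−1}(ε^{d−1})^{−1}` (p35's slice volume against one `(L^kε)^{−(d−1)}`).
[cite: Balaban1983Higgs3, (2.10) p.426] [cite: Balaban1983RegularityDecay, Sect. 5 Theorem p.594] -/
def faceC (P : HiggsLattice.Params) (δ : ℝ) : ℝ := (8 * P.d / δ) ^ (P.d - 1) * (P.mesh 0 ^ (P.d - 1))⁻¹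

/-- `faceC ≥ 0` for `δ > 0`. [cite: Balaban1983Higgs3, (2.10) p.426] -/
theorem faceC_nonneg {δ : ℝ} (hδ : 0 < δ) : 0 ≤ faceC P δ := by
  have := P.mesh_pos 0
  unfold faceC; positivity

/-- the scale algebra of two top bumps over a face: `(L^kε)^{a₁−d}(L^kε)^{a₂−d}(L^k)^{d−1} = (L^kε)^{a₁+a₂−1−d}(ε^{d−1})^{−1}`.
[cite: Balaban1983Higgs3, (2.6) p.424, (2.10) p.426] -/
theorem face_top_scale_algebra (k : ℕ) (a₁ a₂ : ℝ) :
    P.mesh k ^ (a₁ - (P.d : ℝ)) * P.mesh k ^ (a₂ - (P.d : ℝ)) * ((P.L : ℝ) ^ k) ^ (P.d - 1)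
      = P.mesh k ^ (a₁ + a₂ - 1 - (P.d : ℝ)) * (P.mesh 0 ^ (P.d - 1))⁻¹ := by
  have hmk : 0 < P.mesh k := P.mesh_pos k
  have hm0 : 0 < P.mesh 0 := P.mesh_pos 0
  have hd1 : ((P.d - 1 : ℕ) : ℝ) = (P.d : ℝ) - 1 := by rw [Nat.cast_sub P.hd, Nat.cast_one]
  -- `L^k = L^kε / ε`
  have hLk : (P.L : ℝ) ^ k = P.mesh k * (P.mesh 0)⁻¹ := by
    unfold HiggsLattice.Params.mesh
    rw [pow_zero, one_mul, mul_assoc, mul_inv_cancel₀ P.hε.ne', mul_one]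
  rw [hLk, mul_pow, inv_pow, ← Real.rpow_natCast (P.mesh k) (P.d - 1), hd1, mesh_rpow_add, ← mul_assoc, mesh_rpow_add]
  congr 2
  ring

/-- **Two top bumps contracted over one SLICE** (ANY real exponents; `0 < δ ≤ 1`; `F ⊆ {s : s_ν = c}`): if `0 ≤ F(s) ≤ top_k(c₁,a₁;δ)(x,s)` and
`0 ≤ G(s) ≤ top_k(c₂,a₂;δ)(s,y)` on `F`, then `Σ_{s∈F} F(s)G(s) ≤ top_k(c₁c₂·faceC(δ), a₁+a₂−1; δ/2)(x,y)` — p35 g26's `face_conv2_scales_le` at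
`j₁ = j₂ = k`: the exponent is ONE LOWER than over the sites (§2) and the constant ONE `ε` BETTER. [cite: Balaban1983Higgs3, (2.6) p.424, (2.10) p.426] [cite: Balaban1983RegularityDecay, Sect. 5 Theorem p.594] -/
theorem sum_face_top_mul_top_le {k : ℕ} {δ : ℝ} (hδ : 0 < δ) (hδ1 : δ ≤ 1) {a₁ a₂ c₁ c₂ : ℝ} (hc₁ : 0 ≤ c₁) (hc₂ : 0 ≤ c₂)
    {F : Finset (HiggsLattice.Site P 0)} {ν : Fin P.d} {c : ZMod (P.sitesPerDir 0 ν)} (hF : ∀ s ∈ F, s ν = c)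
    (x y : HiggsLattice.Site P 0) (Fk Gk : HiggsLattice.Site P 0 → ℝ) (hG0 : ∀ s ∈ F, 0 ≤ Gk s)
    (hFk : ∀ s ∈ F, Fk s ≤ top P k c₁ a₁ δ x s) (hGk : ∀ s ∈ F, Gk s ≤ top P k c₂ a₂ δ s y) (hF0 : ∀ s ∈ F, 0 ≤ Fk s) :
    ∑ s ∈ F, Fk s * Gk s ≤ top P k (c₁ * c₂ * faceC P δ) (a₁ + a₂ - 1) (δ / 2) x y := by
  have hconv := B3Op116SliceSums.face_conv2_scales_le (P := P) hδ hδ1 k k hF x y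
  rw [min_self, max_self] at hconv
  set E : HiggsLattice.Site P 0 → ℝ := fun u =>
    Real.exp (-(δ * (P.mesh k)⁻¹ * (P.mesh 0 * (HiggsLattice.Site.tdist x u : ℝ)))) *
      Real.exp (-(δ * (P.mesh k)⁻¹ * (P.mesh 0 * (HiggsLattice.Site.tdist u y : ℝ)))) with hE
  have hm : 0 ≤ c₁ * c₂ * (P.mesh k ^ (a₁ - (P.d : ℝ)) * P.mesh k ^ (a₂ - (P.d : ℝ))) :=
    mul_nonneg (mul_nonneg hc₁ hc₂) (mul_nonneg (Real.rpow_nonneg (P.mesh_pos k).le _) (Real.rpow_nonneg (P.mesh_pos k).le _))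
  calc ∑ s ∈ F, Fk s * Gk s
      ≤ ∑ s ∈ F, top P k c₁ a₁ δ x s * top P k c₂ a₂ δ s y :=
        Finset.sum_le_sum fun s hs => mul_le_mul (hFk s hs) (hGk s hs) (hG0 s hs) ((hF0 s hs).trans (hFk s hs))
    _ = c₁ * c₂ * (P.mesh k ^ (a₁ - (P.d : ℝ)) * P.mesh k ^ (a₂ - (P.d : ℝ))) * ∑ s ∈ F, E s := by
        rw [Finset.mul_sum]
        exact Finset.sum_congr rfl fun s _ => by simp only [top, hE]; ring
    _ ≤ c₁ * c₂ * (P.mesh k ^ (a₁ - (P.d : ℝ)) * P.mesh k ^ (a₂ - (P.d : ℝ))) *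
          ((8 * P.d / δ) ^ (P.d - 1) * ((P.L : ℝ) ^ k) ^ (P.d - 1) *
            Real.exp (-(δ / 2 * (P.mesh k)⁻¹ * (P.mesh 0 * (HiggsLattice.Site.tdist x y : ℝ))))) :=
        mul_le_mul_of_nonneg_left hconv hm
    _ = (c₁ * c₂ * (8 * P.d / δ) ^ (P.d - 1)) *
          (P.mesh k ^ (a₁ - (P.d : ℝ)) * P.mesh k ^ (a₂ - (P.d : ℝ)) * ((P.L : ℝ) ^ k) ^ (P.d - 1)) *
          Real.exp (-(δ / 2 * (P.mesh k)⁻¹ * (P.mesh 0 * (HiggsLattice.Site.tdist x y : ℝ)))) := by ring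
    _ = top P k (c₁ * c₂ * faceC P δ) (a₁ + a₂ - 1) (δ / 2) x y := by
        rw [face_top_scale_algebra, top, faceC]; ring

/-- **Far pairing over one SLICE** (`L ≥ 2`, `0 < δ ≤ 1`, `ρ ≥ 1`, `a₁, a₂ ≥ 0`, `c₁, c₂ ≥ 0`; `F ⊆ {s : s_ν = c}`, every `s ∈ F` far from `p`
AND from `x′`): if `0 ≤ F(s) ≤ 𝔪_k(c₁,a₁;δ)(p,s)` and `0 ≤ G(s) ≤ 𝔪_k(c₂,a₂;δ)(s,x′)` on `F`, then
`Σ_{s∈F} F(s)G(s) ≤ top_k(farF·c₁·(farC·c₂)·faceC(δ/2), a₁+a₂−1; δ/4)(p,x′)` — the face legs of the box in the collar rows: with the face charge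
`κ_F = 2dε^{−1}|e|s` on a value state (`a₂ = a_v`) and a kernel of exponent `a_K` the term has the exponent `a_K + a_v − 1` of the bulk
`D`-terms and the normalization `ε^{−d}` (`ε^{−1}·(ε^{d−1})^{−1}`). [cite: Balaban1983Higgs3, (1.16) p.414, (2.10) p.426, p.433] [cite: Balaban1983RegularityDecay, Sect. 5 Theorem p.594] -/
theorem sum_face_far_pair_le (hL2 : 2 ≤ P.L) {k : ℕ} {δ ρ : ℝ} (hδ : 0 < δ) (hδ1 : δ ≤ 1) (hρ : 1 ≤ ρ)
    {a₁ a₂ c₁ c₂ : ℝ} (ha₁ : 0 ≤ a₁) (ha₂ : 0 ≤ a₂) (hc₁ : 0 ≤ c₁) (hc₂ : 0 ≤ c₂)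
    {F : Finset (HiggsLattice.Site P 0)} {ν : Fin P.d} {c : ZMod (P.sitesPerDir 0 ν)} (hF : ∀ s ∈ F, s ν = c)
    (p x' : HiggsLattice.Site P 0) (Fk Gk : HiggsLattice.Site P 0 → ℝ) (hF0 : ∀ s, 0 ≤ Fk s) (hG0 : ∀ s, 0 ≤ Gk s)
    (hFk : ∀ s ∈ F, Fk s ≤ maj P k c₁ a₁ δ p s) (hGk : ∀ s ∈ F, Gk s ≤ maj P k c₂ a₂ δ s x')
    (hfar : ∀ s ∈ F, Far P k ρ p s ∧ Far P k ρ s x') :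
    ∑ s ∈ F, Fk s * Gk s ≤ top P k (farF P δ ρ * c₁ * (farC P δ * c₂) * faceC P (δ / 2)) (a₁ + a₂ - 1) (δ / 4) p x' := by
  have hfF : 0 ≤ farF P δ ρ := (farF_pos hδ ρ).le
  have hfC : 0 ≤ farC P δ := (farC_pos (P := P) hδ).le
  have hρ0 : 0 ≤ ρ := zero_le_one.trans hρ
  have hδ2 : 0 < δ / 2 := by positivity
  have hδ21 : δ / 2 ≤ 1 := by linarith
  have h1 : ∀ s ∈ F, Fk s ≤ top P k (farF P δ ρ * c₁) a₁ (δ / 2) p s := fun s hs =>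
    (hFk s hs).trans (maj_far_le_top hL2 hc₁ ha₁ hδ hρ (hfar s hs).1)
  have h2 : ∀ s ∈ F, Gk s ≤ top P k (farC P δ * c₂) a₂ (δ / 2) s x' := fun s hs => by
    refine (hGk s hs).trans ((maj_far_le_top hL2 hc₂ ha₂ hδ hρ (hfar s hs).2).trans ?_)
    exact top_const_mono (mul_le_mul_of_nonneg_right (farF_le_farC hδ hρ0) hc₂) s x'
  have h := sum_face_top_mul_top_le hδ2 hδ21 (mul_nonneg hfF hc₁) (mul_nonneg hfC hc₂) hF p x' Fk Gk (fun s _ => hG0 s) h1 h2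
    (fun s _ => hF0 s)
  rw [show δ / 2 / 2 = δ / 4 by ring] at h
  exact h

end FacePairs

end Literature.MathematicalPhysics.QuantumFieldTheory.Balaban1983to89.B3Op116CollarRows

end
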